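import Mathlib
import HarnessLib
import HarnessLib.Audit
import Summits.BirchSwinnertonDyer.Statement
import Summits.BirchSwinnertonDyer.Rank1Residual.WAll.TargetAdditiveAtThreeCells
import Summits.BirchSwinnertonDyer.BirchSwinnertonDyer.Theorems.SchneiderFreeAdditiveX3Defs
import Summits.BirchSwinnertonDyer.BirchSwinnertonDyer.Theorems.SchneiderFreeSockets
import Summits.BirchSwinnertonDyer.Rank1Residual.O6.X4CongruenceAnchor
import Literature.NumberTheory.EllipticCurves.NonvanishingTwistsPrescribedSplitting
import Summits.BirchSwinnertonDyer.Rank1Residual.WAll.TargetAdditiveAtThreeWildTwinSlices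
import Literature.NumberTheory.EllipticCurves.Serre1967.PotentiallySupersingularNoStableLine
import Summits.BirchSwinnertonDyer.Rank1Residual.WAll.TargetAdditiveAtThreePotSSImage
import Summits.BirchSwinnertonDyer.Rank1Residual.Additive.WildThreeRefinedKolyvagin
import Summits.BirchSwinnertonDyer.BirchSwinnertonDyer.Theorems.SchneiderFreeUpperSockets
import Summits.BirchSwinnertonDyer.Rank1Residual.X11b.Three.KolyvaginLine
import Literature.NumberTheory.EllipticCurves.MatarNekovar2019.ShaStructureIrreducible
import Literature.NumberTheory.EllipticCurves.CasselsTateLevelInputs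
import Literature.NumberTheory.EllipticCurves.GrossLMS1991.HeegnerEulerSystemCongruenceImageFree
import Literature.NumberTheory.EllipticCurves.HeegnerPointsIdentityComponent
import Literature.NumberTheory.EllipticCurves.PoitouTateSelmerStructuresConj
import Literature.NumberTheory.EllipticCurves.LiuZhangZhang2018.PAdicWaldspurgerEllipticCurveAdditive
import Literature.NumberTheory.EllipticCurves.Hsieh2014.AnticyclotomicPAdicLFunctionAnyLevel
import Literature.NumberTheory.GaloisCohomology.PoitouTateSelmerStructures
import Literature.NumberTheory.EllipticCurves.BDPCentralValueReciprocity
import Summits.BirchSwinnertonDyer.BirchSwinnertonDyer.Theorems.UniversalToricDescentWildSplitFrameAtThreeOddOfPrintOfEngine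
import HarnessLib.Audit.Status.Attr
-- import Summits.BirchSwinnertonDyer.BirchSwinnertonDyer.Theses.SemiOrdinaryEisensteinDescent dropped: it (transitively) imports this route file — proofs used by `closes`/`_holds` must live in a module that does not import the Theses file

/-!
Route: SemiOrdinaryEisensteinDescent

# Route SemiOrdinaryEisensteinDescent — Eisenstein half of the split anticyclotomic main conjecture
at a supercuspidal 3 via semi-ordinary U(3,1) families plus a Manin-robust Kolyvagin bound reads
BSD_3 on the onto wild rank-one cell

It suffices to show X = THE EISENSTEIN INCLUSION AT THE WILD SPLIT PRIME 3 (crux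
`WildSplitEisensteinInclusionAtThree`) together with
its Kolyvagin-side partner and the two local readings the tree already prices: for E/ℚ non-CM, wild
potentially supersingular at 3
(`Additive.ClassO6 W 3`, v₃(N) ∈ {3,4,5}, π₃ supercuspidal), ρ̄_{E,3} onto GL₂(𝔽₃), r_an(E) = 1, and
K an imaginary quadratic Heegner
field for N with 3 = 𝔭𝔭̄ SPLIT: for every anticyclotomic BDP/LZZ frame L of f_E and every prime 𝔭′ ∣
3, whenever the (∅,0) Selmer
dual X_(∅,0)(E/K_∞) is Λ-torsion, `Ch_Λ(X_(∅,0))·R₀⟦T⟧ ⊆ (L)` (X — the «Eisenstein» or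
lower-bound-on-Ш half of the main conjecture,
Jetchev–Skinner–Wan's STEP L); the OPPOSITE inequality on the Heegner index is supplied not by the
other half of the main conjecture
(route UTD's wall `AdditiveSplitIMCInclusionAtThree`, dead to Kolyvagin systems at an additive split
3 by `NoAdmissiblePrimesAtThree` /
trace-zero towers) but DIRECTLY by the classical Kolyvagin system of y_K with the Jetchev refinement
carrying the Tamagawa AND Manin slack
(`WildKolyvaginUpperAtThree`: ord₃#Ш(E/K) + 2·ord₃∏c_q + 2·ord₃c ≤ 2·ord₃[E(K):ℤP] under 3-adic
tower surjectivity). With the unit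
p-adic Waldspurger value (`WildSplitWaldspurgerAtThree`) and exact anticyclotomic control
(`WildSplitControlAtThree`) — both SHARED with
route UniversalToricDescent — the kernel (support `EisensteinKernelAtThree`, = utd-p3's landed
kernel with `heq.le` replaced by X and
`heq.ge` replaced by the Kolyvagin bound) gives the EXACT index at slack v₃(c) and the landed class
theorem p528981
(`SchneiderFree.Exact.bsdp_three_of_exactIndexManin_of_wAllExclAddWildRankZero`) returns BSD₃(E).
The rest of the leaf
`WAllExclAddWildRankOneSurj` (3 894 onto wild r = 1 classes) is carried by two DECLARED RESIDUALS:
the rank-zero wild rows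
`WAllExclAddWildRankZero` BY NAME (the twist E^(d_K)) and the onto-mod-3-but-not-mod-9 rows
(`WildRankOneSurjNonTowerAtThree`, Elkies-type
defects, uncensused). No card realised (novel-route seat bsd-wall-pss3 g4, lens transfer: the solved
sibling is Wan's semi-ordinary
Eisenstein divisibility at a GOOD supersingular p, arXiv:1412.1767 Thm 1.1; the first
non-transferring step — the p-local Fourier–Jacobi
/ pullback computation at a SUPERCUSPIDAL π₃ and the non-square-free level — is the crux).
Lean: `∀ (W : WeierstrassCurve ℚ) [W.IsElliptic] [W.IsGloballyMinimal] (N : ℕ) [NeZero N] (K : Type)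
[Field K] [NumberField K] (Dt :
Literature.NumberTheory.EllipticCurves.ModularForms.ModularParametrizationData W N),
Summit.BirchSwinnertonDyer.Rank1Residual.Additive.ClassO6 W 3 → W.HasSurjectiveModNGaloisRep 3 →
W.analyticRank = 1 → W.conductorNorm ℤ = N →
Literature.NumberTheory.EllipticCurves.IsImaginaryQuadratic K →
Literature.NumberTheory.EllipticCurves.SatisfiesHeegnerHypothesis N K → ∀ (κ :
Literature.NumberTheory.EllipticCurves.ZpExtension K 3), κ.IsAnticyclotomic → ∀ (γ :
Field.absoluteGaloisGroup K) [Fact (κ.IsTopGenerator γ)] (𝔭 : IsDedekindDomain.HeightOneSpectrum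
(NumberField.RingOfIntegers K)), ((3 : ℕ) : NumberField.RingOfIntegers K) ∈ 𝔭.asIdeal →
𝔭.asIdeal.ramificationIdx (NumberField.RingOfIntegers ℚ) = 1 → 𝔭.asIdeal.inertiaDeg
(NumberField.RingOfIntegers ℚ) = 1 → ∀ (𝔭' : IsDedekindDomain.HeightOneSpectrum
(NumberField.RingOfIntegers K)), ((3 : ℕ) : NumberField.RingOfIntegers K) ∈ 𝔭'.asIdeal → 𝔭' ≠ 𝔭 → ∀
(ι' : PadicAlgCl 3 ≃+* ℂ),
Summit.BirchSwinnertonDyer.BirchSwinnertonDyer.Theorems.SchneiderFree.BranchInducesPrime 3 ι' 𝔭 → ∀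
(ΩK : ℂ) (Ωp : ℂ_[3]) (L : Literature.NumberTheory.EllipticCurves.UnrSeries 3), ΩK ≠ 0 → Ωp ≠ 0 →
Literature.NumberTheory.EllipticCurves.IsBDPLFunction ι' 𝔭 κ γ Dt.f ΩK Ωp L → Module.IsTorsion
(Literature.NumberTheory.EllipticCurves.IwasawaAlgebra 3)
(Summit.BirchSwinnertonDyer.Rank1Residual.X11b.AcSelmer.XAc (W.baseChange K) 3 κ 𝔭' ∅ γ) →
(Summit.BirchSwinnertonDyer.Rank1Residual.X11b.AcSelmer.XAc.charIdeal (W.baseChange K) 3 κ 𝔭' ∅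
γ).map (PowerSeries.map (Summit.BirchSwinnertonDyer.Rank1Residual.X11b.Halves.toUnr 3)) ≤ Ideal.span
{L}`

## Assembly
Pure logic (`glue.lean`, kernel-checked in Sketch.lean rc 0): `closes : PublishedInputsWildThree →
WildSplitEisensteinInclusionAtThree → WildKolyvaginUpperAtThree → WildSplitWaldspurgerAtThree →
WildSplitControlAtThree → WildRankZeroTwistAtThree → WildRankOneSurjNonTowerAtThree →
EisensteinKernelAtThree → Summit.BirchSwinnertonDyer.WAllExclAddWildRankOneSurj` (closes_target =
the loaded W-ALL leaf «W-ALL/2@3.O6.r1.surj», 3 894 classes); proof `hK hIn hE hKo hV hC hZ hNT` —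
every binder consumed.

CLOSES_TARGET: closes rung W-ALL/2@3.O6.r1.surj of BirchSwinnertonDyer: Summit.BirchSwinnertonDyer.WAllExclAddWildRankOneSurj (D-0061; not the summit Statement) — the deciding theorem of this route concludes that registered leaf instead of the Statement decl `BirchSwinnertonDyer` (class rung: servable and labelled, never counted as concluding the summit Statement).

Rationale: WHY THIS LINE. The solved sibling is one reduction type away: Wan (arXiv:1412.1767, Thm 1.1
[corpus:paper-arxiv-1412.1767 p0003]) proves the Eisenstein
inclusion `(𝓛_{f,K,ξ}) ⊇ char(X_{f,K,ξ})` of the two-variable Greenberg-type (= (∅,0) at the bottom)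
main conjecture for a weight-2 form that is
GOOD SUPERSINGULAR at p, by Klingen–Eisenstein congruences on U(3,1) in a family that is ordinary
ONLY in the CM/Klingen direction
(«semi-ordinary», Hida theory for the partially ordinary idempotent, his §3 [p0012]) — the
π-variable is never deformed, so the infinite slope
of π_p is no obstruction to the FAMILY; what uses «π_p unramified with distinct Satake parameters»
is the p-local pullback / Fourier–Jacobi
coefficient computation (his §4, Prop 4.3 [p0016]) and «square-free N» the ramified local integrals.
Transfer dictionary: f ↦ f_E with π₃
supercuspidal of conductor 3^f, f ∈ {3,4,5}; the CM family g_ξ ↦ the same (K, 3 split); X_{f,K,ξ}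
specialised to the anticyclotomic line ↦ the
tree's `XAc (W.baseChange K) 3 κ 𝔭′ ∅ γ`; 𝓛 ↦ the BDP/LZZ frame `IsBDPLFunction` (Liu–Zhang–Zhang at
a supercuspidal split 𝔭, Euler factor 1);
Hsieh's mod-p non-vanishing of the CM periods ↦ the tree fact `Hsieh2014.thmB_…_anyLevel` (μ = 0 at
ANY level, p ≠ 2). Imported from:
automorphic forms on unitary groups (doubling / pullback formulae, Klingen Eisenstein families),
p-adic families in the parabolic direction
only, and — on the partner crux — the arithmetic of Kolyvagin systems with Jetchev's Tamagawa
refinement (Jetchev2008 Thm 1.4 / Conj 1.3,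
W. Zhang 2014 §3.8, tree shapes `AdditiveThree.MinftyGe` / `KolyvaginStructureThreeShape`). Why it
is EASIER than the leaf: the two cruxes are
ONE-SIDED inequalities, each with a printed engine one hypothesis away (Wan: good-ss ↦ supercuspidal
at p; Jetchev: p ∤ N ↦ 27 ∣ N with onto-mod-3 image (tower-free since rev 12)), whereas every listed
route at wild 3 needs an EQUALITY of ideals or an EXACT index (UTD 20395/20186: the Kolyvagin
inclusion,
no admissible primes; AKR/K2@3: exact Kolyvagin index, ♯-frame 416 classes; K9/KT: cyclotomic IMC₃ +
a p-adic height that does not exist at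
D_cris = 0). Division of labour = Jetchev–Skinner–Wan 2017 §7.4 (STEP L from the Eisenstein side,
co-STEP L from the Euler-system side),
here with the Euler-system side taken from the HEEGNER-POINT Kolyvagin system over K (upper bound on
Ш needs no admissible/BD primes and
no κ_∞) instead of the anticyclotomic IMC ⊇. utd-p3's data point (STATUS 13:41:41Z): ord₃ I_K ≥ 1 on
all 3 894 classes at the D's of record,
i3 = t3 (pure Tamagawa/Manin) on 3 413 of them — so the Manin/Tamagawa-robust typing of BOTH sockets
(slack v₃(c), T1⁺ with v₃∏c_q + v₃c)
is forced by the habitat, not decoration.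

RANKED CRUXES. (rev 19, 2026-08-28 — act G (Ko′ re-keyed to its research RESIDUE J‴, rev 16–18) and
act G″ (Poitou–Tate conj repair, rev 19); `closes (hIn hE' hPr hPTc hGJ hJ hW hS hZ hK) := hK hIn
hE' hPr (hGJ hPTc) hJ hW hS (fun K _ _ => poitouTate_selmerStructure_duality_of_conj (hPTc K)) hZ`
with hIn 20389 · hE′ 24155 · hPr 25896 · hPTc 23092 · hGJ 26257 · hJ 25898 · hW 24476 · hS 24475 ✓ ·
hZ 20387 · hK 25899 ✓.) #2′ WildSplitEisensteinInclusionAtThreeRestricted (crux, stmt-24155;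
replaces E 20479, now aside) — the RESTRICTED wild-split Eisenstein inclusion at 3: for every
O6/onto/r_an = 1 curve W of conductor N, every Heegner field K for N WITH the Friedberg–Hoffstein
non-vanishing L(E^(d_K),1) ≠ 0 and the Heegner point P = y_K non-torsion, every anticyclotomic
ℤ₃-extension, split degree-one primes 𝔭 ≠ 𝔭′ over 3, branch ι′, periods and BDP/LZZ frame L:
Ch_Λ(X_(∅,0))·R₀⟦T⟧ ⊆ (L) (= E with crux #4's datum binders inserted verbatim; E ⟹ E′ trivially; E′
⟺ E_𝟙′ over the Kolyvagin inclusion + control, p588074 §4). [difficulty: XL] (why it might fail: E′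
is still the Eisenstein half of the BDP main conjecture at an additive potentially-supersingular
split 3 with ρ̄₃ onto: no printed engine (JSW17 §7.4.1 / Castella–Wan need p ≥ 5 or semistable p;
Wan 1412.1767 needs π_p unramified, N square-free); line `birth` on E died ×4; the restriction
removes only the r_an(E/K) ≥ 3 corner, not walls W1–W3.) [JetchevSkinnerWan2017, Castella2018,
BertoliniDarmonPrasanna2013, arXiv:1412.1767, p588074]
#3‴ WildSigmaDivisibilityAtThreeMultiCarrier (crux r3, stmt-25898 = J‴; vet-stamped ×2, 06:03Z /
06:25Z) — THE KOLYVAGIN-SIDE RESEARCH RESIDUE: for E in the cell (ClassO6, ρ̄₃ onto, r_an = 1, N =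
N_E), K Heegner with d_K odd, d_K ≠ −3, L(E^(d_K),1) ≠ 0, P = y_K of infinite order, and a
Kolyvagin–Heegner datum on the frame: the Σ-form 3-power divisibility `Koly.PDiv d 3 s′` of the
derived classes for every s′ ≤ v₃∏_q c_q + v₃c BEYOND the single-carrier maximum — i.e. exactly the
rows with ≥ 2 Tamagawa carriers at 3 or Manin slack, the part of J′ 24702 that Jetchev's max-form
does NOT give (soed-p2-w2 g4/g5 SUBCELLS-JET-TOWER audit; kernel p598295 §2
`wildKolyvaginUpperAtThreeTowerFree_of_sigmaMultiCarrier_of_jetchevMaxModThree_of_threePrimitives`).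
[difficulty: XL] (why it might fail: no Σ-sharp (multi-carrier) Kolyvagin-system divisibility is in
print at any p — Jetchev 2008 Thm 1.4 is max_q only and assumes p ∤ N; the Σ − max gap is Büyükboduk
2009 §4.2 Q1; at 27 ∣ N the Manin slack v₃c carries Manin's conjecture at 3; the (1155k, p = 7, c₃ =
c₅ = 7)-type rows are the gap in print [corpus: Miller 2011 arXiv:1010.2431 p.11/p.15].)
[Jetchev2008, Buyukboduk2009, McCallumLMS1991, Cha2005, arXiv:1010.2431, p598295] HOW Ko′ NOW CLOSES
(all by name, no research left outside J‴): Ko′ 24696 `WildKolyvaginUpperAtThreeTowerFree` ⟸ 25896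
`KolyvaginPrimitivesAtThree` (support := 20191 Cassels–Tate level inputs ∧ 23091 Gross LMS 1991 Prop
3.7(2) ∧ 24701 Gross 1991 E⁰ fact — print) ∧ 25897 `JetchevMaxDivisibilityAtThreeModThree` (support,
Jetchev's max-form at 3 ∣ N under ρ̄₃ onto only, typed `PT → E0 → 3.7(2) → max-form`; DERIVED in
`closes` as hGJ hPTc: 26257 `JetchevMaxOfConjGlue` (support XS := PTc → 25897, closable NOW by
soed-p2-w2's
`…WildKolyvaginUpperAtThreeTowerFreeJetchevMaxModThree.jetchevMaxModThree_of_literature`, scratch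
soedG2/SketchG2.lean rc 0) from 23092 `PoitouTateSelmerDualityConjInput` (support, cite-level: the
FIVE-conjunct conjugation-compatible Poitou–Tate duality `poitouTate_selmerStructure_duality_conj` ∀
K — Milne ADT I 4.10(b) + Neukirch III §6; shared with PrintX9/PrintX10b; it also yields the
four-conjunct PT1 20461 for the kernel by `poitouTate_selmerStructure_duality_of_conj` — act G″
repairs vet tk5i G1: 25897 typed against PT1 alone was not closable from the tree)) ∧ J‴ 25898,
inside kernel 25899 `EisensteinKernelAtThreeMultiCarrierOdd` ✓ (p607926). Ko′ 24696, J′ 24702,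
kernel‴ 24697 ✓, 24609 ✓ are ASIDE since rev 17 (superseded on the deciding chain, texts kept; glue
24703 ✓).
#6 WildRankZeroTwistAtThree (crux, stmt-20387) — RESIDUAL BY NAME (shared with UTD and
CumulativeHeegnerLeopoldt) — the rank-zero wild rows of W-ALL: for every non-CM E/ℚ wild at 3
(ClassO6) with r_an = 0, BSD₃(E) (leaf `WAllExclAddWildRankZero`); the kernel consumes it for the
quadratic twist E^(d_K), again wild at 3 (3 ∤ d_K) with r_an = 0. [difficulty: XL] (why it might
fail: it is the open rank-zero half at an infinite-slope prime: no bounded 3-adic L-function of E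
exists (a₃ = 0, 27 ∣ N), Kato's divisibility at additive p is typed only through Fouquet's
transport, and E^(d_K) may have 3 ∣ #Ш with no Euler-system bound in print.) [Fouquet2025HeckeETNC,
FouquetWan2021, SkinnerUrban2014]
SUPPORT / PRINT binders of `closes`: #9 PublishedInputsWildThree (20389; = UTD's
ToricPublishedInputs, glue 20497 ✓ over six by-name leaves) · 25896 KolyvaginPrimitivesAtThree ·
23092 PoitouTateSelmerDualityConjInput · 26257 JetchevMaxOfConjGlue (XS) · 24476
WildSplitPrintedInputsAtThree (Hsieh 2014 Thm A any level ∧ BDP13 Thm 5.5 ∧ LZZ18 Thm 1.5.1/1.5.3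
additive, BY NAME; shared with UTD) · 24475 WildSplitFrameAtThreeOddOfPrint ✓ (crux #4 at odd d_K
from print, p596578) · 25899 EisensteinKernelAtThreeMultiCarrierOdd ✓ (kernel: PUB → E′ → primitives
→ Jetchev max → J‴ → 24476 → 24475 → PT1 → Z → leaf). IN CONE, NOT BINDERS: 20461
PoitouTateSelmerStructureDualityFact (PT1, four conjuncts; derived from 23092) · 25897 (derived via
26257). ASIDE (banked, not staffed; each superseded on the deciding chain, texts kept as
settled/fallback edges): 20479 E (∀-frame form), 20385 #4 WildSplitWaldspurgerAtThree, 20386 #5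
exact control, 20480 Ko / 20760 J / 20761 (tower forms), 24696 Ko′ / 24702 J′ (tower-free forms,
superseded by the J‴ residue cut), 20484 NT, 20446, 20456, 24474, kernels 20485 ✓ / 24156 ✓ / 24609
✓ / 24697 ✓.

TWO-LAYER PLAN. No live layer 2: Ko′'s rev-13 split (primitives + J′) is superseded by the top-level
residue cut of act G (J‴ + named primitives + Jetchev max-form, all binders or derived). For E′
24155 the registered line `birth` (v3 cf6952029d97d119, 4 stubs: published inputs / the Kolyvagin
INCLUSION at 3 (= UTD wall 20395's text) / the value-at-𝟙 restricted inclusion E_𝟙′ / control;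
composition p588074 §4) says E′ is EQUIVALENT over print to «Kolyvagin inclusion + E_𝟙′»; ACT G′
(QUEUED behind p601567, turnkey pub/bsd-wall/bsd-wall-pss3x/soedH/: SketchGp.lean 1c79562feb51141f
rc 0 against rev 19, edit_Gp.json, glue_Gp.lean v2 163c23551096c6d5 with the act-G″ binders,
retriage_Gp.json, PLAN-Gprime.md + addendum) re-keys E′ ↦ E_𝟙′
`WildSplitEisensteinValueAtOneRestricted` with kernel
`EisensteinKernelAtThreeMultiCarrierOddOfValueAtOne` (closes without hE′/hS; option G′-V = the E_𝟙^V
text of soed-p1-w3 g8 / p609065). J‴'s line `birth` (soed-p2-w2 g5) is registered on 25898.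

KILL CRITERIA. ONE frame at ONE Friedberg–Hoffstein field (odd d_K, L(E^(d_K),1) ≠ 0, y_K
non-torsion) of ONE cell curve with μ(Ch_Λ X_(∅,0)) > μ(L) or λ(Ch) > λ(L) at 𝔭′ (computable for
small conductor via the BDP measure mod 3 and a 9-descent over K) refutes E′ 24155 and closes the
route `refuted:WildSplitEisensteinInclusionAtThreeRestricted`. ONE onto-mod-3 pair (tower or not)
with ord₃#Ш_an(E/K) + 2·ord₃(c·∏c_q) > 2·ord₃[E(K):ℤy_K] (census columns i3, t3 + Ш_an of E and E^D)
refutes Ko′ 24696 — hence J‴ 25898 or a printed primitive — (or BSD₃): utd-p3's 289 INDEX-EXCESS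
classes with 3 ∤ ∏c_q and the 39 Elkies onto-3/not-9 classes are exactly where to look; ONE
Kolyvagin class P(n) over Zhang–Kolyvagin primes of index ≥ s′ that is NOT 3^{s′}-divisible for some
s′ ≤ v₃∏c_q + v₃c refutes J′ 24702; if the offending row has ≥ 2 carriers or Manin slack it refutes
J‴ 25898 itself (single-carrier rows are Jetchev's theorem and cannot fail short of a print error).
If J‴ dies only on non-tower rows, un-aside Ko/J/NT (the tower forms) and re-bind closes: the banked
fallback, not a new route.

NOT DECOMPOSED YET. Inside E′: the semi-ordinary Klingen–Eisenstein family on U(3,1) with a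
supercuspidal local datum at 3, the Fourier–Jacobi non-vanishing mod 3, the lattice construction and
the Σ-primitive descent (walls W1–W3 of the dead `birth` lines on E) — or, on the other reading of
the staged skeleton, UTD's Kolyvagin inclusion 20395 + E_𝟙′; none typable beyond stubs (no
unitary-group automorphic forms in the tree). Inside J‴: a Σ-sharp (multi-carrier) Kolyvagin-system
argument at an additive prime (Büyükboduk Q1: the second carrier's divisibility must come from a
level-raised congruence at TWO primes simultaneously) and the Manin slack at 3 (MANIN-SHADOW memo) —
stubs of line `birth` on 25898 under Cruxes/WildSigmaDivisibilityAtThreeMultiCarrier/, no third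
layer. 26257 is a copy-job (XS).

CHEAPEST FALSIFIER. For the twenty smallest-conductor onto-mod-3 classes of the cell (N = 27·M,
census ROW2-AT3-SUBBLOCKS-v1 / BLOCK-A-index.json; include the 39 Elkies non-tower classes first —
they are new to the habitat since rev 12) and their D of record with odd d_K: compare
2·ord₃[E(K):ℤy_K] (column i3) with ord₃(#Ш_an(E)·#Ш_an(E^D)) + 2·ord₃∏c_q + 2·ord₃c — ONE strict
inequality «index side smaller» kills Ko′ — i.e. J‴ on a multi-carrier row, a PRINT input on a
single-carrier row — (or BSD₃); «index side larger» kills STEP L (hence E′ or the printed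
value/control inputs as typed). utd-p3 reports equality-compatible data on 3 413 jet-product classes
and 481 INDEX-EXCESS classes (Q1 2026-08-27 13:41:41Z) — not run here (kit_allowed = false); it
stays the route's first refuter target.

NUMBERS. Leaf `WAllExclAddWildRankOneSurj` = 3 894 W-ALL residue classes (all onto mod 3; 39 of them
with 3-adic image of index 27 in GL₂(ℤ/9), Elkies 2006 — inside Ko′'s habitat since rev 12; 2 023
twinable = UTD's twin rung) (onto wild r = 1; of the 13 573 wild r = 1: 9 376 reducible, 303
irreducible non-onto are OTHER leaves). v₃(N) ∈ {3,4,5} on ClassO6. utd-p3 partition (census g4/g9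
columns): i3 = min_D ord₃I_K ≥ 1 on all 3 894; i3 = t3 on 2 718 + 522 + 169 + 4 = 3 413;
INDEX-EXCESS 481 (289 with 3 ∤ ∏c_q). Wan 1412.1767: p odd, N square-free, π_p good supersingular;
Wan2020 (ordinary): p ∤ N; Jetchev 2008: p ∤ N·d_K·(index?), ρ̄ onto; Hsieh Thm B any-level: p ≠ 2
(tree fact); LZZ: 𝔭 split only; p528981: landed, sorry-free.

DEFINITION REQUESTS. None at open. Wanted later (informal items on crux 2 after open): automorphic
forms / p-adic families on U(3,1) (notion `SemiOrdinaryKlingenFamily`), the doubling-method p-adic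
L-function as a cite fact (Wan 2015 / Eischen–Harris–Li–Skinner), and a cite fact for Wan 1412.1767
Thm 1.1 itself (good supersingular case) as the BC5 sibling rung.

Novelty: Searches (2026-08-27, this seat): lit search --hybrid «Klingen Eisenstein semi-ordinary
supercuspidal main conjecture» (8 docs:
[corpus:paper:wan2015-iwasawa-main-conjecture-hilbert-modular-forms pp 6,27] = Wan's Hilbert IMC
(ordinary), rest textbook noise); lit vsearch «one divisibility of the anticyclotomic IMC for
Rankin–Selberg … supercuspidal at p» (5 docs, none pertinent); lit search (all, ≥ 2016) «Iwasawa
main conjecture Rankin-Selberg Eisenstein congruence ramified supercuspidal unitary group» →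
[graph:doi:10.2140/ant.2020.14.383] Wan 2020 (ordinary, p ∤ N),
[graph:doi:10.1016/j.jnt.2025.01.015] Barron–Xin 2025 (RS gamma factors of simple supercuspidals of
unitary groups — local theory only), [graph:doi:10.1016/j.jnt.2025.06.007] Jha–Shekhar–Vangala 2026
(RS at an Eisenstein prime), [corpus:paper:arxiv-2408.13932 p9] (Hsieh's Eisenstein-congruence
divisibility for CM fields); lit galaxy search «semi-ordinary|semiordinary|Klingen Eisenstein»
--star all (16 rows: [galaxy:pdf:-496664399860480420] = ANT 2015 vol. 9 (Wan, Hilbert modular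
forms), rest noise); held texts read: [corpus:paper-arxiv-1412.1767 p0003 Thm 1.1, p0012, p0016],
[corpus:paper-arxiv-1411.6352]; tree: rg over Theses/* — no route types the Eisenstein inclusion at
an additive p (UTD 20395 is the OPPOSITE inclusion; AdditiveBranchIMC is the pot-ordinary ω-branch;
EisensteinPrimes/BiquadraticEisensteinDescent are reducible-ρ̄ routes at good/inert p;
SignedLowerHalves is good supersingular ±).
Nearest prior  [refs: 10.2140/ant.2020.14.383, 10.1016/j.jnt.2025.01.015, 10.1016/j.jnt.2025.06.007, 1412.1767, 1411.6352, paper:wan2015-iwasawa-main-conjecture-hilbert-modular-forms, doi:10.2140/ant.2020.14.383, doi:10.1016/j.jnt.2025.01.015, doi:10.1016/j.jnt.2025.06.007, paper:arxiv-2408.13932, paper-arxiv-1412.1767, paper-arxiv-1411.6352, JetchevSkinnerWan2017]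

Barriers (technique_class: eisenstein-congruence, anticyclotomic-iwasawa, kolyvagin): - technique_class: eisenstein-congruence, anticyclotomic-iwasawa, kolyvagin
- Literature.Barriers.BirchSwinnertonDyer.NoAdmissiblePrimesAtThree: EVADED by design — the barrier
kills Kolyvagin/bipartite-Euler-system proofs of the inclusion (L) ⊆ Ch at an additive split 3 (no
admissible or BD primes, trace-zero Heegner tower); crux 2 is the OPPOSITE inclusion proved on the
Eisenstein side (congruences between cusp forms and Klingen Eisenstein series on U(3,1)), which uses
no auxiliary primes at all, and crux 3 uses the CLASSICAL Kolyvagin system of y_K over K (Kolyvagin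
primes ℓ ∤ 3N inert in K exist in abundance; the barrier concerns level-raising at admissible
primes, not Kolyvagin primes).
- Uncatalogued (census/UTD record, not a Barriers decl): the trace-zero Heegner tower at an additive
split p (no norm-compatible κ_∞ at 27 ∣ N) — outside: no Heegner class up the anticyclotomic tower
(κ_∞, big Heegner point) is used; the Iwasawa-theoretic input is the Eisenstein congruence, the
Heegner input is the bottom class y_K only.
- Literature.Barriers.BirchSwinnertonDyer.HeegnerPointBarrier: outside — every cell item carries
r_an(E) = 1 and L(E^(d_K),1) ≠ 0, so r_an(E/K) = 1 and y_K is non-torsion (Gross–Zagier); nothing is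
claimed at analytic rank ≥ 2.
- Literature.Barriers.BirchSwinnertonDyer.HeegnerPointBarrierNarrow: outside for the same reason.
- Literature.Barriers.BirchSwinnertonDyer.SelmerRankBarrier: outside — Ш(E/K)[3^∞] is finite by
Kolyvagin (fact `kolyvagin`, anteceden

sub-problem: BirchSwinnertonDyer · status: open · opened planner-bsd-wall-pss3-g4-0 2026-08-27T14:15:14Z · rev 24 · ledger route-BirchSwinnertonDyer-SemiOrdinaryEisensteinDescent
GENERATED by the gate from the ledger (D-0016/17). Provers cite these decls: `theorem foo : Summit.BirchSwinnertonDyer.BirchSwinnertonDyer.Theses.SemiOrdinaryEisensteinDescent.<Decl> := …` in Summits/BirchSwinnertonDyer/BirchSwinnertonDyer/Theorems/<Name>.lean.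
-/

namespace Summit.BirchSwinnertonDyer.BirchSwinnertonDyer.Theses.SemiOrdinaryEisensteinDescent

open scoped BigOperators Topology Manifold Classical MeasureTheory ProbabilityTheory Matrix InnerProductSpace ComplexConjugate ContinuousMap
open Filter Set Function TopologicalSpace MeasureTheory

attribute [summit_statement] _root_.BirchSwinnertonDyer
attribute [summit_statement] _root_.Summit.BirchSwinnertonDyer.WAllExclAddWildRankOneSurj

open Literature

/-- item stmt-BirchSwinnertonDyer-26610 · crux · rank 2 · open · by planner
why it might fail: It is still the Eisenstein half of the BDP main conjecture at an additive potentially-supersingular split 3, read at 𝟙: no printed engine (JSW17 §7.4.1 / Castella–Wan need p ≥ 5 or semistable p; Wan needs π_p unramified); line birth on E died ×4 at walls W1–W3; only the ∀-character strength is gone.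
sources: JetchevSkinnerWan2017, Castella2018, BertoliniDarmonPrasanna2013, arXiv:1412.1767, p588074, p609065
[crux #2″ = E_𝟙^V — act G′-V; REPLACES E′ 24155 `WildSplitEisensteinInclusionAtThreeRestricted` in
`closes` (E′ → aside, banked)] the MINIMAL Eisenstein currency at the wild split 3: for every O6 /
ρ̄₃-onto / r_an = 1 curve W of conductor N, every Heegner field K with L(W^(d_K),1) ≠ 0, y_K = P
non-torsion and d_K ODD, every anticyclotomic ℤ₃-extension with split degree-one primes 𝔭 ≠ 𝔭′ over
3, branch ι′ inducing 𝔭, periods and BDP frame L with X_(∅,0) Λ-torsion, and every unit u with L(𝟙)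
= u·(log_ω P/c)² (the unit-value display): for every generator f of Ch_Λ(X_(∅,0)(W/K_∞)) at 𝔭′,
‖f(0)‖ ≤ ‖L(𝟙)‖ — the VALUE-AT-𝟙 SHADOW of the Eisenstein inclusion Ch·R₀⟦T⟧ ⊆ (L) (soed-p1-w2 g4
`…WildSplitEisensteinInclusionAtThreeTight` display; = hE1V of p609065 §3 VERBATIM). NECESSARY for
the rung: leaf ⟹ E_𝟙^V (`…Tight.valueAtOneV_of_wAllExclAddWildRankOneSurj`, given print), and E′ ⟹
E_𝟙′ ⟹ E_𝟙^V (`…Tight.valueAtOneV_of_restricted`, p609065 §4) — so it is the weakest crux that can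
sit in this slot and a refutation of it refutes the rung itself. Lines: E′'s registered `birth` v3
(stubs: published inputs / Kolyvagin INCLUSION at 3 = UTD wall 20395 / E_𝟙′ / control) serves it
through E_𝟙′ ⟹ E_𝟙 -/
@[route_item "route-BirchSwinnertonDyer-SemiOrdinaryEisensteinDescent", crux]
def WildSplitEisensteinValueAtOneV : Prop :=
  ∀ (W : WeierstrassCurve ℚ) [W.IsElliptic] [W.IsGloballyMinimal] (N : ℕ) [NeZero N] (K : Type) [Field K] [NumberField K] (Dt : Literature.NumberTheory.EllipticCurves.ModularForms.ModularParametrizationData W N) (H : Literature.NumberTheory.EllipticCurves.HeegnerDatum N (NumberField.discr K)) (ι : K →+* ℂ) (P : (W.baseChange K).toAffine.Point), Summit.BirchSwinnertonDyer.Rank1Residual.Additive.ClassO6 W 3 → W.HasSurjectiveModNGaloisRep 3 → W.analyticRank = 1 → W.conductorNorm ℤ = N → Literature.NumberTheory.EllipticCurves.IsImaginaryQuadratic K → Literature.NumberTheory.EllipticCurves.SatisfiesHeegnerHypothesis N K → (W.quadraticTwist (NumberField.discr K : ℚ)).entireLFunction 1 ≠ 0 → (WeierstrassCurve.Affine.Point.map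 ι.toRatAlgHom) P = Literature.NumberTheory.EllipticCurves.ModularForms.heegnerPointComplex Dt H → ¬ IsOfFinAddOrder P → Odd (NumberField.discr K) → ∀ (κ : Literature.NumberTheory.EllipticCurves.ZpExtension K 3), κ.IsAnticyclotomic → ∀ (γ : Field.absoluteGaloisGroup K) [Fact (κ.IsTopGenerator γ)] (𝔭 : IsDedekindDomain.HeightOneSpectrum (NumberField.RingOfIntegers K)) (h𝔭 : ((3 : ℕ) : NumberField.RingOfIntegers K) ∈ 𝔭.asIdeal) (he : 𝔭.asIdeal.ramificationIdx (NumberField.RingOfIntegers ℚ) = 1) (hf : 𝔭.asIdeal.inertiaDeg (NumberField.RingOfIntegers ℚ) = 1), ∀ (𝔭' : IsDedekindDomain.HeightOneSpectrum (NumberField.RingOfIntegers K)), ((3 : ℕ) : NumberField.RingOfIntegers K) ∈ 𝔭'.asIdeal → 𝔭' ≠ 𝔭 → ∀ (ι' : PadicAlgCl 3 ≃+* ℂ), Summit.BirchSwinnertonDyer.BirchSwinnertonDyer.Theorems.SchneiderFree.BranchInducesPrime 3 ι' 𝔭 → ∀ (ΩK : ℂ) (Ωp : ℂ_[3]) (L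 : Literature.NumberTheory.EllipticCurves.UnrSeries 3), ΩK ≠ 0 → Ωp ≠ 0 → Literature.NumberTheory.EllipticCurves.IsBDPLFunction ι' 𝔭 κ γ Dt.f ΩK Ωp L → Module.IsTorsion (Literature.NumberTheory.EllipticCurves.IwasawaAlgebra 3) (Summit.BirchSwinnertonDyer.Rank1Residual.X11b.AcSelmer.XAc (W.baseChange K) 3 κ 𝔭' ∅ γ) → ∀ (u : (Literature.NumberTheory.EllipticCurves.unrIntegers 3)ˣ), L.HasValueAt 0 ((((u : Literature.NumberTheory.EllipticCurves.unrIntegers 3) : Literature.NumberTheory.EllipticCurves.unrIntegers 3) : ℂ_[3]) * (algebraMap ℚ_[3] ℂ_[3] (Summit.BirchSwinnertonDyer.Rank1Residual.X11b.Halves.logOmega W 3 (Summit.BirchSwinnertonDyer.Rank1Residual.X11b.embAt K 3 𝔭 h𝔭 he hf) P / (Dt.c : ℚ_[3]))) ^ 2) → ∀ (f : Literature.NumberTheory.EllipticCurves.IwasawaAlgebra 3), Summit.BirchSwinnertonDyer.Rank1Residual.X11b.AcSelmer.XAc.charIdeal (W.baseChange K) 3 κ 𝔭' ∅ γ = Ideal.span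 {f} → ‖((PowerSeries.constantCoeff f : ℤ_[3]) : ℚ_[3])‖ ≤ ‖((PowerSeries.constantCoeff L : Literature.NumberTheory.EllipticCurves.unrIntegers 3) : ℂ_[3])‖

/-- item stmt-BirchSwinnertonDyer-25898 · crux · rank 3 · open · by planner
why it might fail: Beyond Jetchev's max the extra 3-divisibility must come from ≥ 2 Tamagawa carriers interacting (or from c(Dt)): Büyükboduk 2009 §4.2 Q1 is OPEN; BCGS 2023 (arXiv:2312.09301) reach the full Tamagawa product only at GOOD ORDINARY p > 3 — at additive p = 3 no Λ-adic control of the carriers is in print.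
sources: Jetchev2008, Buyukboduk2009TamagawaDefect, arXiv:2312.09301, arXiv:2410.23241, McCallumLMS1991, p598295
[crux #3‴ = J‴, the RESEARCH RESIDUE of the Kolyvagin upper bound at the wild prime 3; SUPERSEDES J′
24702 (J′ ⟹ J‴, one binder more) and, with the two print items `KolyvaginPrimitivesAtThree` ∧
`JetchevMaxDivisibilityAtThreeModThree`, gives Ko′ 24696 BY NAME (p598295 §2)] σ-DIVISIBILITY ON
MULTI-CARRIER FRAMES ONLY: for E/ℚ on the wild cell (ClassO6 W 3, ρ̄₃ onto, r_an = 1), K a Heegner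
field with d_K odd ≠ −3 and L(E^{d_K},1) ≠ 0, a non-torsion Heegner point P, and a frame on which NO
single local Tamagawa number carries the whole depth — `∀ q ∣ N, ord₃ c_q(E/ℚ_q) < t`, t := ord₃ ∏
c_q + v₃ c(Dt) (so: ≥ 2 Tamagawa carriers at 3, or a Manin-3 contribution) — the Kolyvagin classes
d(n) at squarefree Kolyvagin n with all indices ≥ s′ are 3-divisible to every depth s′ ≤ t
(`Koly.PDiv d 3 s'`). = hypothesis `hJm` of p598295 §2 VERBATIM = census T17's JET-PRODUCT residue.
In print this is Jetchev 2008 Conj. 1.3 «≥» beyond the max at an ADDITIVE prime = Büyükboduk 2009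
§4.2 Question 1 ⊕ the Manin-3 part; no tower hypothesis (tower-free currency of rev 14). -/
@[route_item "route-BirchSwinnertonDyer-SemiOrdinaryEisensteinDescent", crux]
def WildSigmaDivisibilityAtThreeMultiCarrier : Prop :=
  ∀ (W : WeierstrassCurve ℚ) [W.IsElliptic] [W.IsGloballyMinimal] (N : ℕ) [NeZero N] (K : Type) [Field K] [NumberField K] (Dt : Literature.NumberTheory.EllipticCurves.ModularForms.ModularParametrizationData W N) (H : Literature.NumberTheory.EllipticCurves.HeegnerDatum N (NumberField.discr K)) (ι : K →+* ℂ) (P : (W.baseChange K).toAffine.Point), Summit.BirchSwinnertonDyer.Rank1Residual.Additive.ClassO6 W 3 → W.HasSurjectiveModNGaloisRep 3 → W.analyticRank = 1 → W.conductorNorm ℤ = N → Literature.NumberTheory.EllipticCurves.IsImaginaryQuadratic K → Literature.NumberTheory.EllipticCurves.SatisfiesHeegnerHypothesis N K → (W.quadraticTwist (NumberField.discr K : ℚ)).entireLFunction 1 ≠ 0 → (WeierstrassCurve.Affine.Point.map ι.toRatAlgHom) P = Literature.NumberTheory.EllipticCurves.ModularForms.heegnerPointComplex Dt H → ¬ IsOfFinAddOrder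 P → Odd (NumberField.discr K) → NumberField.discr K ≠ -3 → (∀ (q : ℕ) [Fact q.Prime], q ∣ N → padicValNat 3 ((W.baseChange ℚ_[q]).localTamagawaNumber ℤ_[q]) < padicValNat 3 W.tamagawaProduct + padicValNat 3 Dt.c.natAbs) → ∀ (s' : ℕ), s' ≤ padicValNat 3 W.tamagawaProduct + padicValNat 3 Dt.c.natAbs → ∀ (n : ℕ) (d : Literature.NumberTheory.EllipticCurves.KolyvaginHeegnerData Dt H.β ι n), Squarefree n → (∀ ℓ ∈ n.primeFactors, Literature.NumberTheory.EllipticCurves.Zhang2014.IsKolyvaginPrime N W K 3 ℓ ∧ s' ≤ Literature.NumberTheory.EllipticCurves.Zhang2014.kolyvaginIndex W 3 ℓ) → Summit.BirchSwinnertonDyer.Rank1Residual.X11b.Three.Koly.PDiv d 3 s'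

/-- item stmt-BirchSwinnertonDyer-20387 · crux · rank 6 · open · by planner
why it might fail: It is the open rank-zero half at an infinite-slope prime: no bounded 3-adic L-function of E exists (a₃ = 0, 27 ∣ N), Kato's divisibility at additive p is typed only through Fouquet's transport, and E^(d_K) may have 3 ∣ #Ш with no Euler-system bound in print.
sources: Fouquet2025HeckeETNC, FouquetWan2021, SkinnerUrban2014
[crux] RESIDUAL BY NAME — the rank-zero wild rows of W-ALL: for every non-CM E/ℚ wild at 3 (ClassO6)
with r_an = 0, BSD₃(E) (leaf `WAllExclAddWildRankZero`, K9's `WildRankZero` / W2's engines); the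
kernel consumes it for the quadratic twist E^(d_K), which is again wild at 3 (3 ∤ d_K) with r_an =
0. [difficulty: XL] -/
@[route_item "route-BirchSwinnertonDyer-SemiOrdinaryEisensteinDescent", crux (bottleneck := idea) (source := "ledger wanted_by.residual on stmt-BirchSwinnertonDyer-20387, 2026-09-01")]
def WildRankZeroTwistAtThree : Prop :=
  Summit.BirchSwinnertonDyer.WAllExclAddWildRankZero

/-- item stmt-BirchSwinnertonDyer-20461 · crux · rank 9 · open · by planner
sources: MilneADT2006, Howard2004, p593079, p595286
[support] published fact BY NAME (leaf 1/7 of kmc g17's closer p526934 for crux #5): Poitou–Tate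
duality for Selmer structures over every number field (Milne ADT I 4.10(b); Howard 2004 Thm 2.1.11;
Rubin ES 1.7.3). Cite-level named fact; shared with K1 ControlFacts (19538) conjunct (i). Nothing to
prove at the wild prime. -/
@[route_item "route-BirchSwinnertonDyer-SemiOrdinaryEisensteinDescent", crux]
def PoitouTateSelmerStructureDualityFact : Prop :=
  ∀ (K : Type) [Field K] [NumberField K], Literature.NumberTheory.GaloisCohomology.poitouTate_selmerStructure_duality K

/-- item stmt-BirchSwinnertonDyer-20479 · aside · rank 2 · open · by planner
why it might fail: Wan's engine needs π_p unramified with distinct Satake parameters and N square-free (1412.1767 Thm 1.1): at a supercuspidal π₃ (conductor 3^f, f ≤ 5) the p-local Fourier–Jacobi coefficient may vanish mod 3 for every Klingen section; p = 3 breaks (irred)/(dist) for ξ and Hsieh's p ∤ 6.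
sources: arXiv:1412.1767, arXiv:1411.6352, Wan2020, Hsieh2014, JetchevSkinnerWan2017, LiuZhangZhang2018
[crux] For E in the cell (ClassO6 at 3, ρ̄_{E,3} onto, r_an = 1, N = N(E)), K imaginary quadratic
Heegner for N, every anticyclotomic ℤ₃-extension κ with topological generator γ, every degree-one
prime 𝔭 ∣ 3 with a second prime 𝔭′ ≠ 𝔭 over 3 (3 split), every ι′ inducing 𝔭 and every BDP/LZZ frame
(Ω_K, Ω_p, L) of f_E: if X_(∅,0)(E/K_∞) at 𝔭′ is Λ-torsion then Ch_Λ(X_(∅,0))·R₀⟦T⟧ ⊆ (L) in R₀⟦T⟧ —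
the Eisenstein (lower-bound-on-Ш) half of the split anticyclotomic main conjecture at the
supercuspidal prime 3 (binders = UTD's `AdditiveSplitIMCInclusionAtThree` verbatim, conclusion
reversed, torsion guard added). [difficulty: XL] -/
@[route_item "route-BirchSwinnertonDyer-SemiOrdinaryEisensteinDescent"]
def WildSplitEisensteinInclusionAtThree : Prop :=
  ∀ (W : WeierstrassCurve ℚ) [W.IsElliptic] [W.IsGloballyMinimal] (N : ℕ) [NeZero N] (K : Type) [Field K] [NumberField K] (Dt : Literature.NumberTheory.EllipticCurves.ModularForms.ModularParametrizationData W N), Summit.BirchSwinnertonDyer.Rank1Residual.Additive.ClassO6 W 3 → W.HasSurjectiveModNGaloisRep 3 → W.analyticRank = 1 → W.conductorNorm ℤ = N → Literature.NumberTheory.EllipticCurves.IsImaginaryQuadratic K → Literature.NumberTheory.EllipticCurves.SatisfiesHeegnerHypothesis N K → ∀ (κ : Literature.NumberTheory.EllipticCurves.ZpExtension K 3), κ.IsAnticyclotomic → ∀ (γ : Field.absoluteGaloisGroup K) [Fact (κ.IsTopGenerator γ)] (𝔭 : IsDedekindDomain.HeightOneSpectrum (NumberField.RingOfIntegers K)),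 ((3 : ℕ) : NumberField.RingOfIntegers K) ∈ 𝔭.asIdeal → 𝔭.asIdeal.ramificationIdx (NumberField.RingOfIntegers ℚ) = 1 → 𝔭.asIdeal.inertiaDeg (NumberField.RingOfIntegers ℚ) = 1 → ∀ (𝔭' : IsDedekindDomain.HeightOneSpectrum (NumberField.RingOfIntegers K)), ((3 : ℕ) : NumberField.RingOfIntegers K) ∈ 𝔭'.asIdeal → 𝔭' ≠ 𝔭 → ∀ (ι' : PadicAlgCl 3 ≃+* ℂ), Summit.BirchSwinnertonDyer.BirchSwinnertonDyer.Theorems.SchneiderFree.BranchInducesPrime 3 ι' 𝔭 → ∀ (ΩK : ℂ) (Ωp : ℂ_[3]) (L : Literature.NumberTheory.EllipticCurves.UnrSeries 3), ΩK ≠ 0 → Ωp ≠ 0 → Literature.NumberTheory.EllipticCurves.IsBDPLFunction ι' 𝔭 κ γ Dt.f ΩK Ωp L → Module.IsTorsion (Literature.NumberTheory.EllipticCurves.IwasawaAlgebra 3) (Summit.BirchSwinnertonDyer.Rank1Residual.X11b.AcSelmer.XAc (W.baseChange K) 3 κ 𝔭' ∅ γ) → (Summit.BirchSwinnertonDyer.Rank1Residual.X11b.AcSelmer.XAc.charIdeal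 (W.baseChange K) 3 κ 𝔭' ∅ γ).map (PowerSeries.map (Summit.BirchSwinnertonDyer.Rank1Residual.X11b.Halves.toUnr 3)) ≤ Ideal.span {L}

/-- item stmt-BirchSwinnertonDyer-24155 · aside · rank 2 · open · by planner
why it might fail: E′ is still the Eisenstein half of the BDP main conjecture at an additive pot. supersingular split 3 with ρ̄₃ onto GL₂(𝔽₃): no printed engine (JSW17 §7.4.1 / Castella–Wan need p ≥ 5 or semistable p); line birth on E died ×4; the restriction removes only the r_an(E/K) ≥ 3 corner, not walls W1–W3.
sources: JetchevSkinnerWan2017, Castella2018, BertoliniDarmonPrasanna2013, Skinner2020, arXiv:1512.06894, p588074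
[crux #2′, replaces E 20479 in `closes`] the RESTRICTED wild-split Eisenstein inclusion at 3: for
every O6/surj/r_an = 1 curve W of conductor N, every Heegner field K for N WITH the
Friedberg–Hoffstein nonvanishing L(E^{(d_K)},1) ≠ 0, the Heegner point P = y_K non-torsion, every
anticyclotomic ℤ₃-extension, split primes 𝔭 ≠ 𝔭′ over 3 of degree one, branch ι′, periods and a BDP
L-function frame L: Ch_Λ(X_(∅,0))·R₀⟦T⟧ ⊆ (L). = crux E with crux #4's datum binders inserted
verbatim (E ⟹ E′ trivially; E′ ⟺ E_𝟙′ over Kolyvagin inclusion + control, p588074 §4). Sources: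
JetchevSkinnerWan2017 §7.4.1; Castella2018 Thm 2.3; BertoliniDarmonPrasanna2013 Thm 5.13;
Skinner2020 §2.7; p588074. -/
@[route_item "route-BirchSwinnertonDyer-SemiOrdinaryEisensteinDescent", crux]
def WildSplitEisensteinInclusionAtThreeRestricted : Prop :=
  ∀ (W : WeierstrassCurve ℚ) [W.IsElliptic] [W.IsGloballyMinimal] (N : ℕ) [NeZero N] (K : Type) [Field K] [NumberField K] (Dt : Literature.NumberTheory.EllipticCurves.ModularForms.ModularParametrizationData W N) (H : Literature.NumberTheory.EllipticCurves.HeegnerDatum N (NumberField.discr K)) (ι : K →+* ℂ) (P : (W.baseChange K).toAffine.Point), Summit.BirchSwinnertonDyer.Rank1Residual.Additive.ClassO6 W 3 → W.HasSurjectiveModNGaloisRep 3 → W.analyticRank = 1 → W.conductorNorm ℤ = N → Literature.NumberTheory.EllipticCurves.IsImaginaryQuadratic K → Literature.NumberTheory.EllipticCurves.SatisfiesHeegnerHypothesis N K → (W.quadraticTwist (NumberField.discr K : ℚ)).entireLFunction 1 ≠ 0 → (WeierstrassCurve.Affine.Point.map ι.toRatAlgHom) P = Literature.NumberTheory.EllipticCurves.ModularForms.heegnerPointComplex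 Dt H → ¬ IsOfFinAddOrder P → ∀ (κ : Literature.NumberTheory.EllipticCurves.ZpExtension K 3), κ.IsAnticyclotomic → ∀ (γ : Field.absoluteGaloisGroup K) [Fact (κ.IsTopGenerator γ)] (𝔭 : IsDedekindDomain.HeightOneSpectrum (NumberField.RingOfIntegers K)), ((3 : ℕ) : NumberField.RingOfIntegers K) ∈ 𝔭.asIdeal → 𝔭.asIdeal.ramificationIdx (NumberField.RingOfIntegers ℚ) = 1 → 𝔭.asIdeal.inertiaDeg (NumberField.RingOfIntegers ℚ) = 1 → ∀ (𝔭' : IsDedekindDomain.HeightOneSpectrum (NumberField.RingOfIntegers K)), ((3 : ℕ) : NumberField.RingOfIntegers K) ∈ 𝔭'.asIdeal → 𝔭' ≠ 𝔭 → ∀ (ι' : PadicAlgCl 3 ≃+* ℂ), Summit.BirchSwinnertonDyer.BirchSwinnertonDyer.Theorems.SchneiderFree.BranchInducesPrime 3 ι' 𝔭 → ∀ (ΩK : ℂ) (Ωp : ℂ_[3]) (L : Literature.NumberTheory.EllipticCurves.UnrSeries 3), ΩK ≠ 0 → Ωp ≠ 0 → Literature.NumberTheory.EllipticCurves.IsBDPLFunction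 ι' 𝔭 κ γ Dt.f ΩK Ωp L → Module.IsTorsion (Literature.NumberTheory.EllipticCurves.IwasawaAlgebra 3) (Summit.BirchSwinnertonDyer.Rank1Residual.X11b.AcSelmer.XAc (W.baseChange K) 3 κ 𝔭' ∅ γ) → (Summit.BirchSwinnertonDyer.Rank1Residual.X11b.AcSelmer.XAc.charIdeal (W.baseChange K) 3 κ 𝔭' ∅ γ).map (PowerSeries.map (Summit.BirchSwinnertonDyer.Rank1Residual.X11b.Halves.toUnr 3)) ≤ Ideal.span {L}

/-- item stmt-BirchSwinnertonDyer-20480 · aside · rank 3 · SPLIT (gen 1) into WildSigmaDivisibilityAtThree, KolyvaginStructureInputsAtThree + glue WildKolyvaginUpperAtThreeOfSigma · direct attempts still welcome (low priority) · by planner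
why it might fail: Jetchev 2008 Thm 1.4 gives only m_∞ ≥ max_q ord₃c_q and assumes p ∤ N; the sum over q, the prime q = 3 itself (Kodaira IV/IV*, c₃ = 3) and the Manin part ord₃c have no printed divisibility mechanism, and McCallum's structure theorem at p = 3 with 27 ∣ N is flagged unverified in the tree.
sources: Jetchev2008, Gross1991, Kolyvagin1990, arXiv:1407.1099, BurungaleCastellaSkinnerTian2022
[crux] For E in the cell with 3-adic TOWER surjectivity (ρ_{E,3^n} onto for all n ≥ 1), K imaginary
quadratic Heegner for N(E) with d_K odd, d_K ≠ −3, L(E^(d_K),1) ≠ 0, a parametrisation datum Dt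
(Manin constant c = c(Dt)) and its Heegner point P = y_K of infinite order: ord₃#Ш(E/K) + 2·ord₃∏_q
c_q(E) + 2·ord₃ c ≤ 2·ord₃[E(K):ℤP] (the tree socket `SchneiderFree.Upper.IndexUpperBoundLeAt W 3 K
P (v₃ c)`) — Kolyvagin's structure theorem at p = 3 with 3 ∣ N plus the Jetchev direction M_∞ ≥
ord₃(c·∏c_q) of the refined Kolyvagin conjecture (co-STEP L, Manin-robust). [difficulty: L] -/
@[route_item "route-BirchSwinnertonDyer-SemiOrdinaryEisensteinDescent", crux]
def WildKolyvaginUpperAtThree : Prop :=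
  ∀ (W : WeierstrassCurve ℚ) [W.IsElliptic] [W.IsGloballyMinimal] (N : ℕ) [NeZero N] (K : Type) [Field K] [NumberField K] (Dt : Literature.NumberTheory.EllipticCurves.ModularForms.ModularParametrizationData W N) (H : Literature.NumberTheory.EllipticCurves.HeegnerDatum N (NumberField.discr K)) (ι : K →+* ℂ) (P : (W.baseChange K).toAffine.Point), Summit.BirchSwinnertonDyer.Rank1Residual.Additive.ClassO6 W 3 → W.HasSurjectiveModNGaloisRep 3 → W.analyticRank = 1 → W.conductorNorm ℤ = N → Literature.NumberTheory.EllipticCurves.IsImaginaryQuadratic K → Literature.NumberTheory.EllipticCurves.SatisfiesHeegnerHypothesis N K → (W.quadraticTwist (NumberField.discr K : ℚ)).entireLFunction 1 ≠ 0 → (WeierstrassCurve.Affine.Point.map ι.toRatAlgHom) P = Literature.NumberTheory.EllipticCurves.ModularForms.heegnerPointComplex Dt H → ¬ IsOfFinAddOrder P → Odd (NumberField.discr K) → NumberField.discr K ≠ -3 → Summit.BirchSwinnertonDyer.Rank1Residual.AdditiveThree.TowerSurjThree W → Summit.BirchSwinnertonDyer.BirchSwinnertonDyer.Theorems.SchneiderFree.Upper.IndexUpperBoundLeAt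 W 3 K P (padicValNat 3 Dt.c.natAbs)

-- parent: WildKolyvaginUpperAtThree · child (gen 1)
/--     item stmt-BirchSwinnertonDyer-20760 · aside · rank 301 · open
    parent: WildKolyvaginUpperAtThree · by planner
    why it might fail: Σ-form = Jetchev Conj 1.3 / W. Zhang's refined Kolyvagin conjecture («≥» half) at an ADDITIVE prime: unproved at any p ∣ N; the direct method yields only max (ONE stringent prime; Jetchev Thm 1.4, Büyükboduk §4.2 Q1 open); known at good ordinary p > 3 only through the IMC (BCGS Thm 2).
    sources: arXiv:math/0703431 Conj 1.3, Thm 1.4, Prop 4.9, Thm 6.3, arXiv:2312.09301 Thm 2, Rem 2.2.5, arXiv:0710.3858 §4.2 Questions 1–2, McCallumLMS1991 §5 Cor 5.6, MatarNekovar2019 Thm 0.7, p544141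
[crux J, the research content of Ko] Σ-FORM GLOBAL DIVISIBILITY at the additive prime 3 (utd-p3 g1
receptacle currency, binders = Ko's verbatim): for E wild pot-ss at 3 (ClassO6), ρ̄₃ onto with
3-adic tower, r_an = 1, K Heegner for N with odd d_K ≠ −3 and L(E^{d_K},1) ≠ 0, every derived
Heegner point P_n of a Kolyvagin–Heegner datum on the frame (Dt, H.β, ι) (n square-free, Kolyvagin
primes of index ≥ s′) is 3^{s′}-divisible in E(K[n]) for every s′ ≤ ord₃ ∏_ℓ c_ℓ(E) + v₃(c(Dt)) —
Jetchev 2008 Conj. 1.3 «m_∞ ≥ ord₃(c·∏c_q)» / W. Zhang's refined Kolyvagin conjecture, ≥-half,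
Manin-robust. Habitat: the 3 413 JET-PRODUCT + 192 mixed onto-W r1 classes (census utd-p3 §2). LINES
(steward g5 transfer memo TRANSFER-JETCHEV-AT3-v1): L1 jetchev-multi-stringent — port Jetchev's
stringent-Selmer proof (Prop 4.9's Lang/p-divisibility step at v ∣ 3 replaced by the component-group
lemma of the memo §S3; McCallum Čebotarev under the tower) to get the MAX-form rung at additive 3,
then the multi-prime peeling = Büyükboduk 2009 §4.2 Question 1 (open); L2 bcgs-twist-port — BCGS
2023 Thm 2 / Rem 2.2.5 mechanism (twisted anticyclotomic control with Tamagawa indices + BDP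
reciprocity + KS-control, p > 3 t -/
@[route_item "route-BirchSwinnertonDyer-SemiOrdinaryEisensteinDescent", crux]
def WildSigmaDivisibilityAtThree : Prop :=
  ∀ (W : WeierstrassCurve ℚ) [W.IsElliptic] [W.IsGloballyMinimal] (N : ℕ) [NeZero N] (K : Type) [Field K] [NumberField K] (Dt : Literature.NumberTheory.EllipticCurves.ModularForms.ModularParametrizationData W N) (H : Literature.NumberTheory.EllipticCurves.HeegnerDatum N (NumberField.discr K)) (ι : K →+* ℂ) (P : (W.baseChange K).toAffine.Point), Summit.BirchSwinnertonDyer.Rank1Residual.Additive.ClassO6 W 3 → W.HasSurjectiveModNGaloisRep 3 → W.analyticRank = 1 → W.conductorNorm ℤ = N → Literature.NumberTheory.EllipticCurves.IsImaginaryQuadratic K → Literature.NumberTheory.EllipticCurves.SatisfiesHeegnerHypothesis N K → (W.quadraticTwist (NumberField.discr K : ℚ)).entireLFunction 1 ≠ 0 → (WeierstrassCurve.Affine.Point.map ι.toRatAlgHom) P = Literature.NumberTheory.EllipticCurves.ModularForms.heegnerPointComplex Dt H → ¬ IsOfFinAddOrder P → Odd (NumberField.discr K) → NumberField.discr K ≠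 -3 → Summit.BirchSwinnertonDyer.Rank1Residual.AdditiveThree.TowerSurjThree W → ∀ (s' : ℕ), s' ≤ padicValNat 3 W.tamagawaProduct + padicValNat 3 Dt.c.natAbs → ∀ (n : ℕ) (d : Literature.NumberTheory.EllipticCurves.KolyvaginHeegnerData Dt H.β ι n), Squarefree n → (∀ ℓ ∈ n.primeFactors, Literature.NumberTheory.EllipticCurves.Zhang2014.IsKolyvaginPrime N W K 3 ℓ ∧ s' ≤ Literature.NumberTheory.EllipticCurves.Zhang2014.kolyvaginIndex W 3 ℓ) → Summit.BirchSwinnertonDyer.Rank1Residual.X11b.Three.Koly.PDiv d 3 s'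

-- parent: WildKolyvaginUpperAtThree · child (gen 1)
/--     item stmt-BirchSwinnertonDyer-20761 · aside · rank 302 · open
    parent: WildKolyvaginUpperAtThree · by planner
    sources: Kolyvagin1990 Thm A, MatarNekovar2019 Thm 0.7, §0.11, McCallumLMS1991 Cor 5.6, p544141
[support, published inputs BY NAME — not staffed; closes only by formalising the two facts]
Kolyvagin 1990 Thm A (`kolyvagin N W K`: rank one and Ш(E/K) finite under a Heegner point of
infinite order) ∧ Matar–Nekovář 2019 Thm 0.7 read through §0.11 (`MatarNekovar2019.thm07_…`:
Kolyvagin's structure theorem, upper form in McCallum's currency, ρ̄ irreducible, no reduction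
binder at p, no tower). These are exactly the two named hypotheses of utd-p3 g1's receptacle
`wildKolyvaginUpperAtThree_of_globalDivisibility` (p544141). -/
@[route_item "route-BirchSwinnertonDyer-SemiOrdinaryEisensteinDescent"]
def KolyvaginStructureInputsAtThree : Prop :=
  (∀ (N : ℕ) [NeZero N] (W : WeierstrassCurve ℚ) (K : Type) [Field K] [NumberField K], Literature.NumberTheory.EllipticCurves.kolyvagin N W K) ∧ Literature.NumberTheory.EllipticCurves.MatarNekovar2019.thm07_padicValNat_card_sha_primary_add_le_of_globalDivisibility_of_irreducible

-- parent: WildKolyvaginUpperAtThree · glue (gen 1)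
/--     item stmt-BirchSwinnertonDyer-20762 · support · rank 303 · closed · proved by Summit.BirchSwinnertonDyer.BirchSwinnertonDyer.Theorems.wildKolyvaginUpperAtThreeOfSigma_proof (prover)
    parent: WildKolyvaginUpperAtThree · GLUE: children ⟹ parent · by planner
J (Σ-form global divisibility, WildSigmaDivisibilityAtThree) → KolyvaginStructureInputsAtThree
(kolyvagin ∀-fact ∧ MatarNekovar2019.thm07) → WildKolyvaginUpperAtThree; PROVED by utd-p3 g1's
kernel-certified receptacle IN THE TREE (p544141
`Theorems/SemiOrdinaryEisensteinDescentWildKolyvaginUpperAtThreeOfGlobalDivisibility.lean`): the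
glue item closes by `fun hJ hS =>
WildKolyvaginUpperAtThreeOfGlobalDivisibility.wildKolyvaginUpperAtThree_of_globalDivisibility hS.1
hS.2 hJ` (steward sketch HOME/bsd-wall-pss3/rev17/SketchKoSplit.lean rc 0, 0 sorry; d_K ≠ −4 from
Odd d_K, subst hN, tower binder idle). -/
@[route_item "route-BirchSwinnertonDyer-SemiOrdinaryEisensteinDescent"]
def WildKolyvaginUpperAtThreeOfSigma : Prop :=
  WildSigmaDivisibilityAtThree → KolyvaginStructureInputsAtThree → WildKolyvaginUpperAtThree

-- `WildKolyvaginUpperAtThreeOfSigma` holds: proved by `Summit.BirchSwinnertonDyer.BirchSwinnertonDyer.Theorems.wildKolyvaginUpperAtThreeOfSigma_proof` (its module imports this route file, so no `_holds` link can be stated here).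

/-- item stmt-BirchSwinnertonDyer-24696 · aside · rank 3 · SPLIT (gen 1) into CasselsTateLevelInputsFact, GrossProp372FrobeniusCongruenceInput, GrossHeegnerPointE0Input, WildSigmaDivisibilityAtThreeTowerFree + glue WildKolyvaginUpperAtThreeTowerFreeOfSigma · direct attempts still welcome (low priority) · by planner
why it might fail: Its research child J′ (Σ-form refined Kolyvagin divisibility at additive 3, now also on the 39 onto-mod-3/not-mod-9 r₁ classes, Elkies 2006) is off print: Büyükboduk 2009 §4.2 Q1 ⊕ Manin₃; the −I/Nakayama image argument is certified for McCallum's uses only, not for the Σ-direction.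
sources: McCallumLMS1991, Cha2005, Elkies2006, Jetchev2008, GrossLMS1991, p594241
[crux #3′ — SUPERSEDES Ko stmt-20480 on the deciding chain and ABSORBS the residual crux NT
stmt-20484] Kolyvagin–McCallum upper bound m_∞(P) ≤ ord₃(c) + index bound at the wild prime 3,
exactly 20480's text with the 3-adic tower binder `Rank1Residual.AdditiveThree.TowerSurjThree W →`
DELETED (onto mod 3 only). The tower hypothesis is IDLE on the McCallum road: McCallum 1991 §3
assumes only Gal(ℚ(E_p)/ℚ) = GL₂(ℤ/p) [corpus:book:editornd-l-functions-arithmetic p0279 L17],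
Kolyvagin's order bound is stated under mod-ℓ surjectivity (Cha 2005 Thm 3 / Thm 7: a homothety
gives H¹(G_i, E[ℓ^i]) = 0 ∀ i) [corpus:paper:cha2005 p0002, p0005], and the tree's derivation of the
McCallum named fact consumes its tower binder only as `htower 1`
(Cruxes/WildKolyvaginUpperAtThree/TOWER-IDLE-w2g3.md (soed-p2-w2 g3, sha16 8b5235f264ddd07f)).
LANDED: p594241
`Theorems.WildKolyvaginUpperAtThreeTowerFree.koTowerFree_of_sigmaTowerFree_of_threePrimitives : CT →
3.7(2) → E0 → J′ → Ko′` (= the split of this item), p594519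
`Theorems.EisensteinKernelAtThreeTowerFree.wAllExclAddWildRankOneSurj_of_koTowerFree` (leaf ⟸ PUB +
E′ + Ko′ + V + C + Z, no NT), `Ko′ → Ko` is one `fun` (scratch soedF/SketchSOED2.lean). Ko -/
@[route_item "route-BirchSwinnertonDyer-SemiOrdinaryEisensteinDescent"]
def WildKolyvaginUpperAtThreeTowerFree : Prop :=
  ∀ (W : WeierstrassCurve ℚ) [W.IsElliptic] [W.IsGloballyMinimal] (N : ℕ) [NeZero N] (K : Type) [Field K] [NumberField K] (Dt : Literature.NumberTheory.EllipticCurves.ModularForms.ModularParametrizationData W N) (H : Literature.NumberTheory.EllipticCurves.HeegnerDatum N (NumberField.discr K)) (ι : K →+* ℂ) (P : (W.baseChange K).toAffine.Point), Summit.BirchSwinnertonDyer.Rank1Residual.Additive.ClassO6 W 3 → W.HasSurjectiveModNGaloisRep 3 → W.analyticRank = 1 → W.conductorNorm ℤ = N → Literature.NumberTheory.EllipticCurves.IsImaginaryQuadratic K → Literature.NumberTheory.EllipticCurves.SatisfiesHeegnerHypothesis N K → (W.quadraticTwist (NumberField.discr K : ℚ)).entireLFunction 1 ≠ 0 → (WeierstrassCurve.Affine.Point.map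 ι.toRatAlgHom) P = Literature.NumberTheory.EllipticCurves.ModularForms.heegnerPointComplex Dt H → ¬ IsOfFinAddOrder P → Odd (NumberField.discr K) → NumberField.discr K ≠ -3 → Summit.BirchSwinnertonDyer.BirchSwinnertonDyer.Theorems.SchneiderFree.Upper.IndexUpperBoundLeAt W 3 K P (padicValNat 3 Dt.c.natAbs)

-- parent: WildKolyvaginUpperAtThreeTowerFree · child (gen 1)
/--     item stmt-BirchSwinnertonDyer-20191 · support · rank 301 · open
    parent: WildKolyvaginUpperAtThreeTowerFree · by planner
    sources: MilneADT2006, McCallumLMS1991, p594241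
[support · HELD printed input BY LITERATURE DECL NAME] the levelwise Cassels–Tate inputs for every
number field K: `Literature.NumberTheory.EllipticCurves.casselsTate_levelInputs K` (shim3a g3
p498917; local class field theory invariants + Albert–Brauer–Hasse–Noether + Poitou–Tate H³ + Milne
ADT I §6 cochain recipe + functoriality; discharging it = size XL, no `_holds` attempted). SHARED by
statement across K2 route-BirchSwinnertonDyer-ErratumRoadFive and the @3 routes -ClassRecordThree ∕
-KolyvaginRoadThree: consumed by each `closes` to derive the Shimura Kolyvagin order-bound crux
inline (19718 via K7 p499140; 19899 via p502131 H-form + `…SurjTransport`). Cites: Milne ADT I §6;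
Harari 2020 Prop 8.13/Thm 10.9/Thm 14.11; NSW (8.1.17); Cassels 1962 IV; Tate 1963 ICM; McCallum LMS
1991 §5 Thm 5.4/5.8; Gross LMS 1991 §5 (5.1). -/
@[route_item "route-BirchSwinnertonDyer-SemiOrdinaryEisensteinDescent", crux]
def CasselsTateLevelInputsFact : Prop :=
  ∀ (K : Type) [Field K] [NumberField K], Literature.NumberTheory.EllipticCurves.casselsTate_levelInputs K

-- parent: WildKolyvaginUpperAtThreeTowerFree · child (gen 1)
/--     item stmt-BirchSwinnertonDyer-23091 · support · rank 302 · open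
    parent: WildKolyvaginUpperAtThreeTowerFree · by planner
    sources: GrossLMS1991, p594241
[aside, cite-only] Gross 1991 Prop. 3.7 (2) (Nekovář 2007 Prop. 4.9/4.13(ii)): the Frobenius
congruence y_n ≡ Frob_ℓ y_m (mod λ_n) of the Heegner Euler system, image-free named fact (PUBLISHED;
no mod-p image or CM hypothesis). Print head (γ) of p4's stub_jetchevX9 chain. [cite: GrossLMS1991,
Prop. 3.7 (2) p. 240] [cite: Nekovar2007, Prop. 4.9, 4.13 (ii)] — conjunct 1 of JetchevPrintFactsX9
— filed so the cite_only head constant is item-stated BY NAME (gate5 #15c one rule; staffable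
remedy); banked context (D-0019 aside): never staffed, not progress, closes only when the named fact
becomes a theorem. -/
@[route_item "route-BirchSwinnertonDyer-SemiOrdinaryEisensteinDescent", crux]
def GrossProp372FrobeniusCongruenceInput : Prop :=
  Literature.NumberTheory.EllipticCurves.GrossLMS1991.prop37_2_frobeniusCongruence

-- parent: WildKolyvaginUpperAtThreeTowerFree · child (gen 1)
/--     item stmt-BirchSwinnertonDyer-24701 · support · rank 303 · open
    parent: WildKolyvaginUpperAtThreeTowerFree · by planner
    sources: GrossLMS1991, p594241
[support, published fact BY NAME — McCallum-road primitive (iii)] Gross 1991: the Heegner point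
minus a rational torsion point lies in the identity component E⁰
(`Gross1991_heegnerPoint_sub_ratTorsion_mem_E0`). = line birth v4 stub_inputsPrim conjunct 3. -/
@[route_item "route-BirchSwinnertonDyer-SemiOrdinaryEisensteinDescent", crux]
def GrossHeegnerPointE0Input : Prop :=
  Literature.NumberTheory.EllipticCurves.Gross1991_heegnerPoint_sub_ratTorsion_mem_E0

-- parent: WildKolyvaginUpperAtThreeTowerFree · child (gen 1)
/--     item stmt-BirchSwinnertonDyer-24702 · aside · rank 304 · open
    parent: WildKolyvaginUpperAtThreeTowerFree · by planner
    why it might fail: No Σ-sharp Kolyvagin-system divisibility at a prime of ADDITIVE reduction is in print (Jetchev 2008 needs p ∤ N·disc, Howard's hypotheses need ρ_{E,p^∞} onto); Büyükboduk 2009 §4.2 Q1 is open and the Manin constant at 3 enters; tower-free adds the index-27-image classes (Elkies 2006).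
    sources: Jetchev2008, McCallumLMS1991, Elkies2006, Cha2005, p594241
[crux #3′a — THE research content of Ko′; = J stmt-20760's text VERBATIM minus the tower binder]
Σ-form global 3-power divisibility of the Kolyvagin derivative classes P(n) (Jetchev direction of
the refined Kolyvagin conjecture, Manin-robust currency s′ ≤ v₃(∏c_q) + v₃(c)) for every onto-mod-3
wild-at-3 r_an = 1 curve at a Heegner field with odd d_K ≠ −3. Ko′ ⟸ this + the three primitives by
p594241 `koTowerFree_of_sigmaTowerFree_of_threePrimitives`. Line `birth` v5 = v4
(Cruxes/WildKolyvaginUpperAtThree/Lines/birth.lean, skeleton 4e4d10fd) with stub_sigma := this decl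
BY NAME — to be registered under the new crux dir by a seat holding its write ACL. [difficulty: XL] -/
@[route_item "route-BirchSwinnertonDyer-SemiOrdinaryEisensteinDescent", crux]
def WildSigmaDivisibilityAtThreeTowerFree : Prop :=
  ∀ (W : WeierstrassCurve ℚ) [W.IsElliptic] [W.IsGloballyMinimal] (N : ℕ) [NeZero N] (K : Type) [Field K] [NumberField K] (Dt : Literature.NumberTheory.EllipticCurves.ModularForms.ModularParametrizationData W N) (H : Literature.NumberTheory.EllipticCurves.HeegnerDatum N (NumberField.discr K)) (ι : K →+* ℂ) (P : (W.baseChange K).toAffine.Point), Summit.BirchSwinnertonDyer.Rank1Residual.Additive.ClassO6 W 3 → W.HasSurjectiveModNGaloisRep 3 → W.analyticRank = 1 → W.conductorNorm ℤ = N → Literature.NumberTheory.EllipticCurves.IsImaginaryQuadratic K → Literature.NumberTheory.EllipticCurves.SatisfiesHeegnerHypothesis N K → (W.quadraticTwist (NumberField.discr K : ℚ)).entireLFunction 1 ≠ 0 → (WeierstrassCurve.Affine.Point.map ι.toRatAlgHom) P = Literature.NumberTheory.EllipticCurves.ModularForms.heegnerPointComplex Dt H → ¬ IsOfFinAddOrder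 P → Odd (NumberField.discr K) → NumberField.discr K ≠ -3 → ∀ (s' : ℕ), s' ≤ padicValNat 3 W.tamagawaProduct + padicValNat 3 Dt.c.natAbs → ∀ (n : ℕ) (d : Literature.NumberTheory.EllipticCurves.KolyvaginHeegnerData Dt H.β ι n), Squarefree n → (∀ ℓ ∈ n.primeFactors, Literature.NumberTheory.EllipticCurves.Zhang2014.IsKolyvaginPrime N W K 3 ℓ ∧ s' ≤ Literature.NumberTheory.EllipticCurves.Zhang2014.kolyvaginIndex W 3 ℓ) → Summit.BirchSwinnertonDyer.Rank1Residual.X11b.Three.Koly.PDiv d 3 s'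

-- parent: WildKolyvaginUpperAtThreeTowerFree · glue (gen 1)
/--     item stmt-BirchSwinnertonDyer-24703 · support · rank 305 · closed · proved by Summit.BirchSwinnertonDyer.BirchSwinnertonDyer.Theorems.wildKolyvaginUpperAtThreeTowerFreeOfSigma_proof (prover)
    parent: WildKolyvaginUpperAtThreeTowerFree · GLUE: children ⟹ parent · by planner
Ko′ ⟸ CT → 3.7(2) → E0 → J′: PROVABLE NOW in one line — `fun h₁ h₂ h₃ h₄ ↦
Summit.BirchSwinnertonDyer.BirchSwinnertonDyer.Theorems.WildKolyvaginUpperAtThreeTowerFree.koTowerFree_of_sigmaTowerFree_of_threePrimitives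
h₁ h₂ h₃ h₄` (p594241, soed-p2-w2 g3; certified by `exact` in scratch soedF/SketchSOED2.lean
c6362bbd4edb60b4 `koTowerFree_glue`). -/
@[route_item "route-BirchSwinnertonDyer-SemiOrdinaryEisensteinDescent"]
def WildKolyvaginUpperAtThreeTowerFreeOfSigma : Prop :=
  CasselsTateLevelInputsFact → GrossProp372FrobeniusCongruenceInput → GrossHeegnerPointE0Input → WildSigmaDivisibilityAtThreeTowerFree → WildKolyvaginUpperAtThreeTowerFree

-- `WildKolyvaginUpperAtThreeTowerFreeOfSigma` holds: proved by `Summit.BirchSwinnertonDyer.BirchSwinnertonDyer.Theorems.wildKolyvaginUpperAtThreeTowerFreeOfSigma_proof` (its module imports this route file, so no `_holds` link can be stated here).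

/-- item stmt-BirchSwinnertonDyer-20385 · aside · rank 4 · open · by planner
why it might fail: LZZ Thm 1.8's constant carries the local toric period of the test vector at the supercuspidal place (conductor 3^f, f ≤ 5) and #𝓞_K^×/2; its 3-adic valuation may be positive (u not a unit), and matching LZZ's measure to the (ΩK, Ωp^{4n}) interpolation clause may fail.
sources: LiuZhangZhang2018, BertoliniDarmonPrasanna2013, CastellaHsieh2018
[crux] For E in the cell with datum (N, K, Dt, H, ι, P = the Heegner point, non-torsion,
L(E^(d_K),1) ≠ 0) and every anticyclotomic frame (κ, γ, 𝔭 ∣ 3 of degree one): there is ι′ inducing 𝔭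
and an LZZ p-adic L-function L ∈ R₀⟦T⟧ in the tree's `IsBDPLFunction` currency for Dt.f, whose value
at the trivial character is u·(log_{ω_E}P/c)² with u a UNIT of R₀ (Liu–Zhang–Zhang Thm 1.6/1.8 at a
supercuspidal 𝔭: Euler-type factor 1 since a₃(f_E) = 0 and ε(3) = 0). [difficulty: L] -/
@[route_item "route-BirchSwinnertonDyer-SemiOrdinaryEisensteinDescent", crux]
def WildSplitWaldspurgerAtThree : Prop :=
  ∀ (W : WeierstrassCurve ℚ) [W.IsElliptic] [W.IsGloballyMinimal] (N : ℕ) [NeZero N] (K : Type) [Field K] [NumberField K] (Dt : Literature.NumberTheory.EllipticCurves.ModularForms.ModularParametrizationData W N) (H : Literature.NumberTheory.EllipticCurves.HeegnerDatum N (NumberField.discr K)) (ι : K →+* ℂ) (P : (W.baseChange K).toAffine.Point), Summit.BirchSwinnertonDyer.Rank1Residual.Additive.ClassO6 W 3 → W.HasSurjectiveModNGaloisRep 3 → W.analyticRank = 1 → W.conductorNorm ℤ = N → Literature.NumberTheory.EllipticCurves.IsImaginaryQuadratic K → Literature.NumberTheory.EllipticCurves.SatisfiesHeegnerHypothesis N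 K → (W.quadraticTwist (NumberField.discr K : ℚ)).entireLFunction 1 ≠ 0 → (WeierstrassCurve.Affine.Point.map ι.toRatAlgHom) P = Literature.NumberTheory.EllipticCurves.ModularForms.heegnerPointComplex Dt H → ¬ IsOfFinAddOrder P → ∀ (κ : Literature.NumberTheory.EllipticCurves.ZpExtension K 3), κ.IsAnticyclotomic → ∀ (γ : Field.absoluteGaloisGroup K) [Fact (κ.IsTopGenerator γ)] (𝔭 : IsDedekindDomain.HeightOneSpectrum (NumberField.RingOfIntegers K)) (h𝔭 : ((3 : ℕ) : NumberField.RingOfIntegers K) ∈ 𝔭.asIdeal) (he : 𝔭.asIdeal.ramificationIdx (NumberField.RingOfIntegers ℚ) = 1) (hf : 𝔭.asIdeal.inertiaDeg (NumberField.RingOfIntegers ℚ) = 1), ∃ ι' : PadicAlgCl 3 ≃+* ℂ, Summit.BirchSwinnertonDyer.BirchSwinnertonDyer.Theorems.SchneiderFree.BranchInducesPrime 3 ι' 𝔭 ∧ ∃ (ΩK : ℂ) (Ωp : ℂ_[3]) (L : Literature.NumberTheory.EllipticCurves.UnrSeries 3), ΩK ≠ 0 ∧ Ωp ≠ 0 ∧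 Literature.NumberTheory.EllipticCurves.IsBDPLFunction ι' 𝔭 κ γ Dt.f ΩK Ωp L ∧ ∃ u : (Literature.NumberTheory.EllipticCurves.unrIntegers 3)ˣ, L.HasValueAt 0 ((((u : Literature.NumberTheory.EllipticCurves.unrIntegers 3) : Literature.NumberTheory.EllipticCurves.unrIntegers 3) : ℂ_[3]) * (algebraMap ℚ_[3] ℂ_[3] (Summit.BirchSwinnertonDyer.Rank1Residual.X11b.Halves.logOmega W 3 (Summit.BirchSwinnertonDyer.Rank1Residual.X11b.embAt K 3 𝔭 h𝔭 he hf) P / (Dt.c : ℚ_[3]))) ^ 2)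

/-- item stmt-BirchSwinnertonDyer-20386 · aside · rank 5 · open · by planner
why it might fail: The count was derived (K1) on pot-ordinary/multiplicative cells; at pot-supersingular 3 the finiteness of E(K_{∞,𝔭̄})[3^∞] up the ramified tower and the formal-group index m₀ (Ẽ_ns(𝔽₃) ≅ 𝔽₃, c₃ ≤ 4) must re-enter with no unit-root line; p = 3 Poitou–Tate steps.
sources: JetchevSkinnerWan2017, Castella2018, Greenberg1999LNM
[crux] For E in the cell with the same datum and Kolyvagin's finiteness as antecedent, at every
anticyclotomic frame the exact control count of the tree's additive currency holds: ∃ n, Ch(X_{∅,0})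
has valuation n at 𝟙 and n = ord₃#Ш(E/K)[3^∞] + 2·(ord₃ log_ω P − ord₃[E(K):ℤP]) + ord₃ ∏_{w split}
c_w (`SchneiderFree.AdditiveControlOnTreeAt 3`), i.e. Jetchev–Skinner–Wan's anticyclotomic control
theorem at a potentially supersingular split 3. [difficulty: M] -/
@[route_item "route-BirchSwinnertonDyer-SemiOrdinaryEisensteinDescent"]
def WildSplitControlAtThree : Prop :=
  ∀ (W : WeierstrassCurve ℚ) [W.IsElliptic] [W.IsGloballyMinimal] (N : ℕ) [NeZero N] (K : Type) [Field K] [NumberField K] (Dt : Literature.NumberTheory.EllipticCurves.ModularForms.ModularParametrizationData W N) (H : Literature.NumberTheory.EllipticCurves.HeegnerDatum N (NumberField.discr K)) (ι : K →+* ℂ) (P : (W.baseChange K).toAffine.Point), Summit.BirchSwinnertonDyer.Rank1Residual.Additive.ClassO6 W 3 → W.HasSurjectiveModNGaloisRep 3 → W.analyticRank = 1 → W.conductorNorm ℤ = N → Literature.NumberTheory.EllipticCurves.IsImaginaryQuadratic K → Literature.NumberTheory.EllipticCurves.SatisfiesHeegnerHypothesis N K → (W.quadraticTwist (NumberField.discr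 K : ℚ)).entireLFunction 1 ≠ 0 → (WeierstrassCurve.Affine.Point.map ι.toRatAlgHom) P = Literature.NumberTheory.EllipticCurves.ModularForms.heegnerPointComplex Dt H → ¬ IsOfFinAddOrder P → Literature.NumberTheory.EllipticCurves.kolyvagin N W K → ∀ (κ : Literature.NumberTheory.EllipticCurves.ZpExtension K 3), κ.IsAnticyclotomic → ∀ (γ : Field.absoluteGaloisGroup K) [Fact (κ.IsTopGenerator γ)] (𝔭 : IsDedekindDomain.HeightOneSpectrum (NumberField.RingOfIntegers K)) (h𝔭 : ((3 : ℕ) : NumberField.RingOfIntegers K) ∈ 𝔭.asIdeal) (he : 𝔭.asIdeal.ramificationIdx (NumberField.RingOfIntegers ℚ) = 1) (hf : 𝔭.asIdeal.inertiaDeg (NumberField.RingOfIntegers ℚ) = 1), Summit.BirchSwinnertonDyer.BirchSwinnertonDyer.Theorems.SchneiderFree.AdditiveControlOnTreeAt 3 κ 𝔭 γ (Summit.BirchSwinnertonDyer.Rank1Residual.X11b.embAt K 3 𝔭 h𝔭 he hf) P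

/-- item stmt-BirchSwinnertonDyer-20484 · aside · rank 7 · open · by planner
why it might fail: Without tower surjectivity Kolyvagin's Čebotarev step at level 3^M (M ≥ 2) fails and no refined index bound is in print; the rows may need the full main conjecture (UTD) — it is declared residual, no evasion claimed.
sources: Gross1991, arXiv:math/0612734, Jetchev2008
[crux] RESIDUAL — the onto-mod-3 rows of the leaf whose 3-ADIC TOWER is not surjective (ρ̄_{E,3}
onto GL₂(𝔽₃) but ρ_{E,9} not onto GL₂(ℤ/9): Elkies' mod-9 defects): non-CM E wild at 3, ρ̄₃ onto,
¬TowerSurjThree, r_an = 1 ⟹ BSD₃(E). Mass uncensused (census ROW2-AT3-SUBBLOCKS-v1 §notes: «mod-9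
defect not checked, rare»); a data ask to bsd-wall-census (galrep mod 9 on the 3 894 classes).
[difficulty: L] -/
@[route_item "route-BirchSwinnertonDyer-SemiOrdinaryEisensteinDescent"]
def WildRankOneSurjNonTowerAtThree : Prop :=
  ∀ (W : WeierstrassCurve ℚ) [W.IsElliptic] [W.IsGloballyMinimal], ¬ W.HasCM → Summit.BirchSwinnertonDyer.Rank1Residual.Additive.ClassO6 W 3 → W.HasSurjectiveModNGaloisRep 3 → ¬ Summit.BirchSwinnertonDyer.Rank1Residual.AdditiveThree.TowerSurjThree W → W.analyticRank = 1 → Literature.NumberTheory.EllipticCurves.BSDp W 3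

/-- item stmt-BirchSwinnertonDyer-20316 · support · rank 9 · open · by planner
sources: LiuZhangZhang2018, p518041, p540475
[support] Published input BY NAME (pattern β, director-bsd GO-β-W 2026-08-27T10:29:03Z):
Liu–Zhang–Zhang, Duke Math. J. 167 (2018) Thm 1.5.1 ∧ Thm 1.5.3 read at an additive prime (p-adic
Waldspurger formula on the modular curve + non-vanishing of the Heegner vector); typed fact
`Literature.NumberTheory.EllipticCurves.LiuZhangZhang2018.thm151_thm153_modularCurve_heegnerVector_additive`
(p518041, reviewed). Consumed by KatzWaldspurgerFrameCMInertBadFlatOfLZZ in closes. Why it might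
fail: only if the typed additive reading over-states Thm 1.5.3 (ε-factor / level hypotheses at the
additive place). Sources: doi:10.1215/00127094-2017-0045, arXiv:1511.08172, arXiv:1408.1733. -/
@[route_item "route-BirchSwinnertonDyer-SemiOrdinaryEisensteinDescent"]
def LiuZhangZhangAdditiveInput : Prop :=
  Literature.NumberTheory.EllipticCurves.LiuZhangZhang2018.thm151_thm153_modularCurve_heegnerVector_additive

/-- item stmt-BirchSwinnertonDyer-20389 · support · rank 9 · SPLIT (gen 1) into RankEqAnalyticRankLeOne, EntireLFunctionRat, ModularParametrizationSupply, BSDQuotientIsogenyInvariance, GrossZagierRationalPointI73, FriedbergHoffsteinHeegnerSplitDivisorsTwist, ToricParametrisedInputs + glue PublishedInputsWildThreeGlue · direct attempts still welcome (low priority) · by planner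
sources: GrossZagier1986, Kolyvagin1990, FriedbergHoffstein1995, JetchevSkinnerWan2017
[support] The published inputs the kernel consumes, by name: Gross–Zagier, Kolyvagin,
Gross–Zagier–Kolyvagin rank theorem, modularity, a parametrisation datum, BSD-quotient isogeny
invariance, GZ86 I.(7.3), Friedberg–Hoffstein Thm B with prescribed splitting at the divisors of
N(E) and of M = N(E′), parity, Heegner points over K. [difficulty: provable-now] -/
@[route_item "route-BirchSwinnertonDyer-SemiOrdinaryEisensteinDescent", crux]
def PublishedInputsWildThree : Prop :=
  (∀ (N : ℕ) [NeZero N] (W : WeierstrassCurve ℚ) (K : Type) [Field K] [NumberField K], Literature.NumberTheory.EllipticCurves.gross_zagier N W K) ∧ (∀ (N : ℕ) [NeZero N] (W : WeierstrassCurve ℚ) (K : Type) [Field K] [NumberField K], Literature.NumberTheory.EllipticCurves.kolyvagin N W K) ∧ Literature.NumberTheory.EllipticCurves.rank_eq_analyticRank_of_analyticRank_le_one ∧ WeierstrassCurve.hasEntireLFunction_rat ∧ Literature.NumberTheory.EllipticCurves.ModularForms.nonempty_modularParametrizationData ∧ WeierstrassCurve.bsdRHS_eq_of_isIsogenous ∧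 Literature.NumberTheory.EllipticCurves.GrossZagier1986_thm_I_7_3 ∧ Literature.NumberTheory.EllipticCurves.friedbergHoffstein_exists_heegnerField_splitDivisors_twist_ne_zero ∧ (∀ (W : WeierstrassCurve ℚ), Literature.NumberTheory.EllipticCurves.even_analyticRank_iff_rootNumber_eq_one W) ∧ (∀ (W : WeierstrassCurve ℚ) (K : Type) [Field K] [NumberField K], Literature.NumberTheory.EllipticCurves.exists_isHeegnerPoint W K)

-- parent: PublishedInputsWildThree · child (gen 1)
/--     item stmt-BirchSwinnertonDyer-19921 · support · rank 901 · open
    parent: PublishedInputsWildThree · by operator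
    sources: GrossZagier1986, Kolyvagin1990
[support] The one PUBLISHED input the halves-glue consumes: Gross–Zagier–Kolyvagin, rank = analytic
rank for analytic rank ≤ 1 with Ш finite (tree named fact
rank_eq_analyticRank_of_analyticRank_le_one; used by bsdp_of_missingPPartAt to turn Miller's last
clause into BSD(E,2)). Carried as a displayed PUB hypothesis; never counted as progress. The further
PRINT of the roads to the two halves (Greenberg Thm-4.1 analogues at a multiplicative prime
thm41Analogue_charValue_rankZero_numberField_anyPrime / …_split_baseChange_anyPrime, modularity) and
the referee-passed MEMO inputs (Kato ⊗ℚ at a multiplicative 2: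
X5.O1.KatoMultiplicativeDivisibilityRat W 2, HOME mult/PROOF-MULT.md RC-2; Greenberg–Stevens at 2:
greenberg_stevens W 2, mult/PROOF-GS2.md RC-4) enter the LINES under the halves (bridge
multiplicativeRankZeroAtTwo_of_muRoad, p409679), not this glue. -/
@[route_item "route-BirchSwinnertonDyer-SemiOrdinaryEisensteinDescent"]
def RankEqAnalyticRankLeOne : Prop :=
  Literature.NumberTheory.EllipticCurves.rank_eq_analyticRank_of_analyticRank_le_one

-- parent: PublishedInputsWildThree · child (gen 1)
/--     item stmt-BirchSwinnertonDyer-19273 · support · rank 902 · open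
    parent: PublishedInputsWildThree · by planner
    sources: BreuilConradDiamondTaylor2001
[support] entire continuation of L(E/ℚ, s) (modularity: Breuil–Conrad–Diamond–Taylor 2001 Thm A +
Hecke/Shimura), BY NAME — conjunct of MultConversePublishedInputsAtTwo (19185); same content, filed
so the head constant is item-stated (#15c one rule; cite_only dep) -/
@[route_item "route-BirchSwinnertonDyer-SemiOrdinaryEisensteinDescent"]
def EntireLFunctionRat : Prop :=
  WeierstrassCurve.hasEntireLFunction_rat

-- parent: PublishedInputsWildThree · child (gen 1)
/--     item stmt-BirchSwinnertonDyer-19266 · support · rank 903 · open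
    parent: PublishedInputsWildThree · by planner
    sources: BreuilConradDiamondTaylor2001
[support] modularity of E/ℚ as parametrisation data (Breuil–Conrad–Diamond–Taylor 2001 Thm A), BY
NAME — conjunct of OrdPublishedInputsAtTwo (19149; Literature.Uncategorized.OrdPublishedInputsAtTwo
l.26); same content, filed so the head constant is item-stated (#15c one rule; cite_only dep) -/
@[route_item "route-BirchSwinnertonDyer-SemiOrdinaryEisensteinDescent"]
def ModularParametrizationSupply : Prop :=
  Literature.NumberTheory.EllipticCurves.ModularForms.nonempty_modularParametrizationData

-- parent: PublishedInputsWildThree · child (gen 1)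
/--     item stmt-BirchSwinnertonDyer-19307 · support · rank 904 · open
    parent: PublishedInputsWildThree · by operator
    sources: Cassels1965, Milne1986ADT
[support] Cassels 1965 (Arithmetic on curves of genus 1, VIII; J. reine angew. Math. 217) / Milne
ADT Thm I.7.3 and Rem I.7.4: the BSD quotient (right-hand side of the BSD formula) is invariant
under isogeny over ℚ — conjunct of the support PrintedFacts (stmt-BirchSwinnertonDyer-19362), BY
NAME; same content, filed as a split child so the head constant is item-stated (gate5 #15c one rule;
readiness rule 2026-08-15: cite_only dep declared by the route; director-bsd 2026-08-26T04:22Z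
«K3/E2 shape»); no crux statement / closes / tribunal change -/
@[route_item "route-BirchSwinnertonDyer-SemiOrdinaryEisensteinDescent"]
def BSDQuotientIsogenyInvariance : Prop :=
  WeierstrassCurve.bsdRHS_eq_of_isIsogenous

-- parent: PublishedInputsWildThree · child (gen 1)
/--     item stmt-BirchSwinnertonDyer-19369 · support · rank 905 · open
    parent: PublishedInputsWildThree · by planner
    sources: GrossZagier1986
[aside] Gross–Zagier 1986 Thm. I.(7.3) (p. 231; proof V.§2 pp. 310–313): L′(E,1) ≠ 0 ⇒ a rational
point of infinite order (via a Heegner point and the GZ formula) — a cite_only dep of this route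
reached through the depth-1 support item PublishedInputsIMCReduction
(stmt-BirchSwinnertonDyer-19283, child of 19061; a third item layer is forbidden, so it is
item-stated here as a by-name ASIDE: banked context, never staffed, BC6-exempt; gate5 02:15:40Z
«aside also counts»); no crux statement / closes / tribunal change -/
@[route_item "route-BirchSwinnertonDyer-SemiOrdinaryEisensteinDescent"]
def GrossZagierRationalPointI73 : Prop :=
  Literature.NumberTheory.EllipticCurves.GrossZagier1986_thm_I_7_3

-- parent: PublishedInputsWildThree · child (gen 1)
/--     item stmt-BirchSwinnertonDyer-19449 · support · rank 906 · open
    parent: PublishedInputsWildThree · by planner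
    sources: FriedbergHoffstein1995
[aside] Friedberg–Hoffstein 1995 Thm. B (special case; with Waldspurger / Bump–Friedberg–Hoffstein):
a Heegner field K for N with prescribed primes SPLIT and L(E^{d_K},1) ≠ 0 (used by HeegnerTwistData
19183 to supply the B6 Heegner datum at an additive p) — a cite_only dep of this route
(deps.unproved, rev 6), item-stated here as a BY-NAME ASIDE so the route's dependency cone is
declared (gate5 02:15:40Z «aside also counts»; ErratumRoadFive 19369–19375 / K1 19303–19307
precedent): banked context, never staffed, BC6-exempt, closes only by formalisation; no crux
statement / closes / tribunal / tribunal_fit change. Filed by the route base unit P2 g8 for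
STAFFABLE (director-bsd 04:57:54Z E2). sources: FriedbergHoffstein1995, JetchevSkinnerWan2017 §7.4.1 -/
@[route_item "route-BirchSwinnertonDyer-SemiOrdinaryEisensteinDescent"]
def FriedbergHoffsteinHeegnerSplitDivisorsTwist : Prop :=
  Literature.NumberTheory.EllipticCurves.friedbergHoffstein_exists_heegnerField_splitDivisors_twist_ne_zero

-- parent: PublishedInputsWildThree · child (gen 1)
/--     item stmt-BirchSwinnertonDyer-20428 · support · rank 907 · open
    parent: PublishedInputsWildThree · by planner
    sources: GrossZagier1986, Kolyvagin1990, JetchevSkinnerWan2017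
[support, PUB parametrised] the four parametrised published inputs (Gross–Zagier, Kolyvagin, parity,
Heegner points over K) the kernel consumes at the chosen (N, W, K). -/
@[route_item "route-BirchSwinnertonDyer-SemiOrdinaryEisensteinDescent"]
def ToricParametrisedInputs : Prop :=
  (∀ (N : ℕ) [NeZero N] (W : WeierstrassCurve ℚ) (K : Type) [Field K] [NumberField K], Literature.NumberTheory.EllipticCurves.gross_zagier N W K) ∧ (∀ (N : ℕ) [NeZero N] (W : WeierstrassCurve ℚ) (K : Type) [Field K] [NumberField K], Literature.NumberTheory.EllipticCurves.kolyvagin N W K) ∧ (∀ (W : WeierstrassCurve ℚ), Literature.NumberTheory.EllipticCurves.even_analyticRank_iff_rootNumber_eq_one W) ∧ (∀ (W : WeierstrassCurve ℚ) (K : Type) [Field K] [NumberField K], Literature.NumberTheory.EllipticCurves.exists_isHeegnerPoint W K)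

-- parent: PublishedInputsWildThree · glue (gen 1)
/--     item stmt-BirchSwinnertonDyer-20497 · support · rank 908 · closed · proved by Summit.BirchSwinnertonDyer.BirchSwinnertonDyer.Theorems.publishedInputsWildThreeGlue_proof (prover)
    parent: PublishedInputsWildThree · GLUE: children ⟹ parent · by planner
pure logic: the six named facts and the parametrised conjunction reassemble PublishedInputsWildThree
(And.intro in the item's order) — identical to UTD glue stmt-BirchSwinnertonDyer-20429 (proved by
Theorems.toricPublishedInputsGlue_proof: intro h1 … h7; exact ⟨h7.1, h7.2.1, h1, h2, h3, h4, h5, h6,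
h7.2.2.1, h7.2.2.2⟩) -/
@[route_item "route-BirchSwinnertonDyer-SemiOrdinaryEisensteinDescent"]
def PublishedInputsWildThreeGlue : Prop :=
  RankEqAnalyticRankLeOne → EntireLFunctionRat → ModularParametrizationSupply → BSDQuotientIsogenyInvariance → GrossZagierRationalPointI73 → FriedbergHoffsteinHeegnerSplitDivisorsTwist → ToricParametrisedInputs → PublishedInputsWildThree

-- `PublishedInputsWildThreeGlue` holds: proved by `Summit.BirchSwinnertonDyer.BirchSwinnertonDyer.Theorems.publishedInputsWildThreeGlue_proof` (its module imports this route file, so no `_holds` link can be stated here).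

/-- item stmt-BirchSwinnertonDyer-20446 · aside · rank 9 · open · by planner
[aside] Matar–Nekovář 2019 Thm 0.7 (Kolyvagin 1991 Thm C/D; McCallum 1991 §5 Cor 5.6) as the tree's
named fact, stated alone for the deps census (item-states); the Ko split's support child
KolyvaginStructureInputsAtThree (20761) carries it inside a conjunction together with `∀ N W K,
kolyvagin N W K`. Not a target: banked context only. -/
@[route_item "route-BirchSwinnertonDyer-SemiOrdinaryEisensteinDescent"]
def MatarNekovarShaStructure : Prop :=
  Literature.NumberTheory.EllipticCurves.MatarNekovar2019.thm07_padicValNat_card_sha_primary_add_le_of_globalDivisibility_of_irreducible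

/-- item stmt-BirchSwinnertonDyer-20456 · aside · rank 9 · open · by planner
sources: Hsieh2014, p479919
[support] published input, by name: Hsieh, Doc. Math. 19 (2014) Thm A at ANY level (no ¬ p² ∣ N;
periods (Ω_K, Ω_p) with Ω_p ∈ R₀ˣ) = the tree fact
`Literature.NumberTheory.EllipticCurves.Hsieh2014.thmA_exists_isHsiehLFunction_unrPeriod_anyLevel`
(def : Prop, cite-tagged). Consumed by `closes` as the antecedent of (W♭); gives the ♭-frame's
EXISTENCE via the landed `…KatzWaldspurgerFrameCMInertBadFromPrint.exists_frameInt_of_thmA_anyLevel`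
(p508877). Closable only by formalising the fact or by an operator grant; it is the route's declared
print input, not a crux. -/
@[route_item "route-BirchSwinnertonDyer-SemiOrdinaryEisensteinDescent"]
def HsiehAnyLevelInput : Prop :=
  Literature.NumberTheory.EllipticCurves.Hsieh2014.thmA_exists_isHsiehLFunction_unrPeriod_anyLevel

/-- item stmt-BirchSwinnertonDyer-20485 · aside · rank 9 · closed · proved by Summit.BirchSwinnertonDyer.BirchSwinnertonDyer.Theorems.semiOrdinaryEisensteinDescent_eisensteinKernelAtThree_proof (prover) · by planner
sources: JetchevSkinnerWan2017, GrossZagier1986, Kolyvagin1990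
[support] THE KERNEL (Jetchev–Skinner–Wan §7.4 at the wild split 3, Manin-robust, ONE-SIDED halves):
published inputs → Eisenstein inclusion → Kolyvagin upper bound → Waldspurger unit value → exact
control → rank-zero twist → non-tower residual ⟹ the leaf. Proof plan (=
`Theorems/UniversalToricDescentToricKernelAtThree.lean` ll. 92–197 with two substitutions): split on
`TowerSurjThree W` (else the residual); choose K by Friedberg–Hoffstein for 2·N (3 split, d_K odd,
all ℓ ∣ N split ⇒ d_K ≠ −3), the datum, Heegner point; control gives torsion + the count n; `hlow`
from the Eisenstein inclusion exactly as from `heq.le`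
(`Supersingular.two_mul_valuation_le_of_mem_span`, `indexLowerBoundLeAt_of_imcLowerLe_of_control`);
`hupI` := the Kolyvagin crux; then p528981
`SchneiderFree.Exact.bsdp_three_of_exactIndexManin_of_wAllExclAddWildRankZero`. [difficulty: M] -/
@[route_item "route-BirchSwinnertonDyer-SemiOrdinaryEisensteinDescent"]
def EisensteinKernelAtThree : Prop :=
  PublishedInputsWildThree → WildSplitEisensteinInclusionAtThree → WildKolyvaginUpperAtThree → WildSplitWaldspurgerAtThree → WildSplitControlAtThree → WildRankZeroTwistAtThree → WildRankOneSurjNonTowerAtThree → Summit.BirchSwinnertonDyer.WAllExclAddWildRankOneSurj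

-- `EisensteinKernelAtThree` holds: proved by `Summit.BirchSwinnertonDyer.BirchSwinnertonDyer.Theorems.semiOrdinaryEisensteinDescent_eisensteinKernelAtThree_proof` (its module imports this route file, so no `_holds` link can be stated here).

/-- item stmt-BirchSwinnertonDyer-23092 · support · rank 9 · open · by planner
why it might fail: Cite-level print input: Milne ADT I 4.10(b) gives the four duality conjuncts; the fifth (IsConjCompatible for every σ ∈ Aut(K/ℚ)) is Neukirch III §6's remark typed but unproved in the tree — it could only fail by a sign/normalisation mismatch inside `LocalInvariants`, which would also break road K.
sources: MilneADT2006, Neukirch2013, Howard2004HeegnerKolyvagin, Jetchev2008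
[aside, cite-only] Poitou–Tate duality for Selmer structures with a conjugation-compatible family of
local invariant maps, for every number field K (Milne ADT I Cor. 2.3 / Thm 2.6 / Thm 4.10(b), Howard
2004 Thm 2.1.11, Neukirch III §6): PUBLISHED, image-free; the duality input of McCallum §4–§5 /
Jetchev §6 walk. [cite: MilneADT2006, I Thm. 4.10(b)] [cite: Howard2004HeegnerKolyvagin, Thm.
2.1.11] — conjunct 2 of JetchevPrintFactsX9 — filed so the cite_only head constant is item-stated BY
NAME (gate5 #15c one rule; staffable remedy); banked context (D-0019 aside): never staffed, not
progress, closes only when the named fact becomes a theorem. -/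
@[route_item "route-BirchSwinnertonDyer-SemiOrdinaryEisensteinDescent", crux]
def PoitouTateSelmerDualityConjInput : Prop :=
  ∀ (K : Type) [Field K] [NumberField K], Literature.NumberTheory.GaloisCohomology.poitouTate_selmerStructure_duality_conj K

/-- item stmt-BirchSwinnertonDyer-24156 · aside (kind.auto-crux: conjecture-grade) · rank 9 · closed · proved by Summit.BirchSwinnertonDyer.BirchSwinnertonDyer.Theorems.semiOrdinaryEisensteinDescent_eisensteinKernelAtThreeRestricted_proof (prover) · by planner
why it might fail: auto-crux — conjecture-grade statement (statement references the registered conjecture Summit.BirchSwinnertonDyer.WAllExclAddWildRankOneSurj); it is open, so it may simply be false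
sources: p588074, JetchevSkinnerWan2017
[support, RESTRICTED KERNEL — PROVABLE NOW, one line] the route kernel re-run with the Eisenstein
step fed by E′ at the Friedberg–Hoffstein field where hLt, hP, hnt are in hand: `fun hF hE' hKo hV
hC hZ hNT =>
Summit.BirchSwinnertonDyer.BirchSwinnertonDyer.Theorems.WildSplitEisensteinInclusionAtThreeRankOneRestriction.wAllExclAddWildRankOneSurj_of_restricted
hF hE' hKo hV hC hZ hNT` (p588074; pen verify sketch rc 0). Sources: p588074, JetchevSkinnerWan2017. -/
@[route_item "route-BirchSwinnertonDyer-SemiOrdinaryEisensteinDescent"]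
def EisensteinKernelAtThreeRestricted : Prop :=
  PublishedInputsWildThree → WildSplitEisensteinInclusionAtThreeRestricted → WildKolyvaginUpperAtThree → WildSplitWaldspurgerAtThree → WildSplitControlAtThree → WildRankZeroTwistAtThree → WildRankOneSurjNonTowerAtThree → Summit.BirchSwinnertonDyer.WAllExclAddWildRankOneSurj

-- `EisensteinKernelAtThreeRestricted` holds: proved by `Summit.BirchSwinnertonDyer.BirchSwinnertonDyer.Theorems.semiOrdinaryEisensteinDescent_eisensteinKernelAtThreeRestricted_proof` (its module imports this route file, so no `_holds` link can be stated here).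

/-- item stmt-BirchSwinnertonDyer-24474 · aside · rank 9 · open · by planner
sources: BertoliniDarmonPrasanna2013
[aside, by-name single-fact alias — same rule] Bertolini–Darmon–Prasanna 2013 Thm 5.5 with (5.1.16),
Prop 1.12 (1), Lemma 5.3 (Duke Math. J. 162 p. 60): for f the newform of E (conductor N), K
imaginary quadratic Heegner for N with d_K ODD, a period Ω ≠ 0 and a number field F ⊇ K unramified
above every odd prime split in K such that every σ ∈ Aut(ℂ/F) permutes the normalised central values
L(f/K, χ, 1)/(π^{2n+1} Ω^{4n}) of the everywhere-unramified χ of type (n, −n) equivariantly; typed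
fact `Literature.NumberTheory.EllipticCurves.bertoliniDarmonPrasanna2013_centralValue_reciprocity`
(reviewed; tree consumers ClassRecordThreeOpenValueReciprocityOfBDP,
MordellShaFreeCutThreeAdicExistenceFromPrint). Conjunct of WildSplitPrintedInputsAtThree, antecedent
of WildSplitFrameAtThreeOddOfPrint. Banked context: never staffed. -/
@[route_item "route-BirchSwinnertonDyer-SemiOrdinaryEisensteinDescent"]
def BDPCentralValueReciprocityInput : Prop :=
  Literature.NumberTheory.EllipticCurves.bertoliniDarmonPrasanna2013_centralValue_reciprocity

/-- item stmt-BirchSwinnertonDyer-24475 · aside · rank 9 · closed · proved by Summit.BirchSwinnertonDyer.BirchSwinnertonDyer.Theorems.wildSplitFrameAtThreeOddOfPrint_proof (prover) · by planner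
sources: Hsieh2014, BertoliniDarmonPrasanna2013, CastellaHsieh2018, Castella2018, p479919
[support — CRUX #4d AT ODD d_K FROM PRINT; PROVABLE NOW by ONE mechanical port; replaces 20928 (and,
with the package + kernel♯, 20385) on the critical path] Hsieh-2014-any-level fact → BDP13-Thm-5.5
fact → [item 20928 `WildSplitFrameAtThree` VERBATIM with ONE binder `Odd (NumberField.discr K)`
inserted after the Heegner hypothesis]: for W wild at 3 (ClassO6, 27 ∣ N), K Heegner for N with d_K
ODD, (κ, γ) anticyclotomic, 𝔭 ∋ 3, some ι′ induces 𝔭 and an R₀-valued frame (Ω_K ≠ 0, Ω_p ≠ 0, L ∈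
R₀⟦T⟧) with Castella's interpolation property `IsBDPLFunction ι′ 𝔭 κ γ Dt.f Ω_K Ω_p L` exists. WHY ♯
SUFFICES: both kernels (TwinChoiceKernelAtThree l.128/l.155, SOED RankOneRestriction l.257/l.286)
use crux #4 only at a Friedberg–Hoffstein field with 2 split, after deriving `hodd`. CLOSER:
utd-idea g13's Sketch `pub/bsd-wall/bsd-wall-utd-idea/Sketch-utd-idea-g13.lean` (c7defdb691e92c70;
rc 0, 0 sorry) proves `wildSplitFrameAtThreeOdd_of_two_facts_of_engine : Hsieh-any-level → BDP13 →
HsiehDescentEngineAtThree → S♯` (T1 value reciprocity from BDP13, T2♯ Hsieh witness + descent ⟹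
frame, λ supplied by X11b.lambdaSupplyAt); the ONLY open input is THE PORT E
`HsiehDescentEngineAtThree` = cn100's `Mor -/
@[route_item "route-BirchSwinnertonDyer-SemiOrdinaryEisensteinDescent"]
def WildSplitFrameAtThreeOddOfPrint : Prop :=
  Literature.NumberTheory.EllipticCurves.Hsieh2014.thmA_exists_isHsiehLFunction_unrPeriod_anyLevel → Literature.NumberTheory.EllipticCurves.bertoliniDarmonPrasanna2013_centralValue_reciprocity → ∀ (W : WeierstrassCurve ℚ) [W.IsElliptic] [W.IsGloballyMinimal] (N : ℕ) [NeZero N] (K : Type) [Field K] [NumberField K] (Dt : Literature.NumberTheory.EllipticCurves.ModularForms.ModularParametrizationData W N), Summit.BirchSwinnertonDyer.Rank1Residual.Additive.ClassO6 W 3 → W.conductorNorm ℤ = N → Literature.NumberTheory.EllipticCurves.IsImaginaryQuadratic K → Literature.NumberTheory.EllipticCurves.SatisfiesHeegnerHypothesis N K → Odd (NumberField.discr K) → ∀ (κ : Literature.NumberTheory.EllipticCurves.ZpExtension K 3), κ.IsAnticyclotomic → ∀ (γ : Field.absoluteGaloisGroup K) [Fact (κ.IsTopGenerator γ)] (𝔭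 : IsDedekindDomain.HeightOneSpectrum (NumberField.RingOfIntegers K)), ((3 : ℕ) : NumberField.RingOfIntegers K) ∈ 𝔭.asIdeal → ∃ ι' : PadicAlgCl 3 ≃+* ℂ, Summit.BirchSwinnertonDyer.BirchSwinnertonDyer.Theorems.SchneiderFree.BranchInducesPrime 3 ι' 𝔭 ∧ ∃ (ΩK : ℂ) (Ωp : ℂ_[3]) (L : Literature.NumberTheory.EllipticCurves.UnrSeries 3), ΩK ≠ 0 ∧ Ωp ≠ 0 ∧ Literature.NumberTheory.EllipticCurves.IsBDPLFunction ι' 𝔭 κ γ Dt.f ΩK Ωp L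

/-- `WildSplitFrameAtThreeOddOfPrint` holds: proved by `Summit.BirchSwinnertonDyer.BirchSwinnertonDyer.Theorems.wildSplitFrameAtThreeOddOfPrint_proof`. -/
theorem WildSplitFrameAtThreeOddOfPrint_holds : WildSplitFrameAtThreeOddOfPrint := _root_.Summit.BirchSwinnertonDyer.BirchSwinnertonDyer.Theorems.wildSplitFrameAtThreeOddOfPrint_proof

/-- item stmt-BirchSwinnertonDyer-24476 · support · rank 9 · open · by planner
sources: Hsieh2014, BertoliniDarmonPrasanna2013, LiuZhangZhang2018
[support, by-name PACKAGE of the refereed inputs of crux #4♯ — exists because `closes` may bind only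
TOP-LEVEL items (pattern of 23651 / 20692)] Hsieh 2014 Thm A any level (alias HsiehAnyLevelInput) ∧
BDP13 Thm 5.5 (alias BDPCentralValueReciprocityInput) ∧ Liu–Zhang–Zhang 2018 Thm 1.5.1/1.5.3
additive (item 20316 `LiuZhangZhangAdditiveInput`, shared with BiquadraticEisensteinDescent;
p518041). Consumed by ToricKernelAtThreeApZeroOdd; a displayed hypothesis of `closes` — the route
closes MODULO these printed inputs exactly as it already did modulo LZZ through 20385's split glue
(20929). Closes only by formalisation of the three facts (`⟨h₁, h₂, h₃⟩`); nobody should staff it. -/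
@[route_item "route-BirchSwinnertonDyer-SemiOrdinaryEisensteinDescent", crux]
def WildSplitPrintedInputsAtThree : Prop :=
  Literature.NumberTheory.EllipticCurves.Hsieh2014.thmA_exists_isHsiehLFunction_unrPeriod_anyLevel ∧ Literature.NumberTheory.EllipticCurves.bertoliniDarmonPrasanna2013_centralValue_reciprocity ∧ LiuZhangZhangAdditiveInput

/-- item stmt-BirchSwinnertonDyer-24609 · aside (kind.auto-crux: conjecture-grade) · rank 9 · closed · proved by Summit.BirchSwinnertonDyer.BirchSwinnertonDyer.Theorems.semiOrdinaryEisensteinDescent_eisensteinKernelAtThreeRestrictedOdd_proof (prover) · by planner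
why it might fail: auto-crux — conjecture-grade statement (statement references the registered conjecture Summit.BirchSwinnertonDyer.WAllExclAddWildRankOneSurj); it is open, so it may simply be false
sources: JetchevSkinnerWan2017, LiuZhangZhang2018, Castella2018, FriedbergHoffstein1995, p588074
[support, RESTRICTED KERNEL WITH CRUX #4 AT ODD d_K — PROVABLE NOW (six lines); replaces 24156 in
`closes`] 24156 `EisensteinKernelAtThreeRestricted` with `WildSplitWaldspurgerAtThree →` replaced by
`WildSplitPrintedInputsAtThree → WildSplitFrameAtThreeOddOfPrint →`. CLOSER (scratch
soedB/SketchSOED.lean rc 0, 0 sorry): `intro hF hE' hKo hW hS hC hZ hNT; obtain ⟨hH, hB, hL⟩ := hW;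
exact
Theorems.EisensteinKernelAtThreeRestrictedOfFrameOdd.wAllExclAddWildRankOneSurj_of_restricted_of_frameOdd
hF hE' hKo hL (hS hH hB) hC hZ hNT` (soed-p1-w3 g6's landed file
SemiOrdinaryEisensteinDescentEisensteinKernelAtThreeRestrictedOfFrameOdd.lean, --supports 24155).
One Theorems file importing the route file + that file, `--workitem <this item>`. [difficulty: XS] -/
@[route_item "route-BirchSwinnertonDyer-SemiOrdinaryEisensteinDescent"]
def EisensteinKernelAtThreeRestrictedOdd : Prop :=
  PublishedInputsWildThree → WildSplitEisensteinInclusionAtThreeRestricted → WildKolyvaginUpperAtThree → WildSplitPrintedInputsAtThree → WildSplitFrameAtThreeOddOfPrint → WildSplitControlAtThree → WildRankZeroTwistAtThree → WildRankOneSurjNonTowerAtThree → Summit.BirchSwinnertonDyer.WAllExclAddWildRankOneSurj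

-- `EisensteinKernelAtThreeRestrictedOdd` holds: proved by `Summit.BirchSwinnertonDyer.BirchSwinnertonDyer.Theorems.semiOrdinaryEisensteinDescent_eisensteinKernelAtThreeRestrictedOdd_proof` (its module imports this route file, so no `_holds` link can be stated here).

/-- item stmt-BirchSwinnertonDyer-24697 · aside (kind.auto-crux: conjecture-grade) · rank 9 · closed · proved by Summit.BirchSwinnertonDyer.BirchSwinnertonDyer.Theorems.semiOrdinaryEisensteinDescent_eisensteinKernelAtThreeTowerFreeOdd_proof (prover) · by planner
why it might fail: None mathematically (both parents landed, std axioms); the only risk is clerical — step (o) of p595286 interleaving with the frame-odd call (it does not in p588074/p594519).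
sources: p595286, p594519, p588074, p594734
[support, S — the `closes` kernel‴ = tower-free ⊕ odd-d_K ⊕ PT1: leaf ⟸ PUB + E′ (24155) + Ko′ +
WildSplitPrintedInputsAtThree (24476) + WildSplitFrameAtThreeOddOfPrint (24475) + PT1 + Z (20387);
no V (#4), no C (#5), no NT (#7) sockets] CLOSER RECIPE (mechanical merge of two landed verbatim
variants of bed-p3's kernel): start from p595286
`Theorems.EisensteinKernelAtThreeRestrictedOfControlLe.wAllExclAddWildRankOneSurj_of_restricted_of_frameOdd_of_poitouTate`
(PUB → E′ → Ko → LZZ → frame-odd → PT1 → Z → NT → leaf) and delete step (o) (the `TowerSurjThree`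
case split + NT call), calling Ko′ where Ko was called with `htower` — exactly the surgery p594519
`Theorems.EisensteinKernelAtThreeTowerFree.wAllExclAddWildRankOneSurj_of_koTowerFree` performed on
p588074; then `intro hF hE' hKo hW hS hPT hZ; obtain ⟨hH, hB, hL⟩ := hW; exact merged hF hE' hKo hL
(hS hH hB) hPT hZ`. Sockets certified in scratch soedF/SketchSOED2.lean c6362bbd4edb60b4
(`kernel_towerFreeOdd_withNT` via p595286 with Ko′ ↦ Ko, `kernel_towerFree_VC` via p594519,
closes″). Supersedes 24609 `EisensteinKernelAtThreeRestrictedOdd` (→ aside). -/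
@[route_item "route-BirchSwinnertonDyer-SemiOrdinaryEisensteinDescent"]
def EisensteinKernelAtThreeTowerFreeOdd : Prop :=
  PublishedInputsWildThree → WildSplitEisensteinInclusionAtThreeRestricted → WildKolyvaginUpperAtThreeTowerFree → WildSplitPrintedInputsAtThree → WildSplitFrameAtThreeOddOfPrint → PoitouTateSelmerStructureDualityFact → WildRankZeroTwistAtThree → Summit.BirchSwinnertonDyer.WAllExclAddWildRankOneSurj

-- `EisensteinKernelAtThreeTowerFreeOdd` holds: proved by `Summit.BirchSwinnertonDyer.BirchSwinnertonDyer.Theorems.semiOrdinaryEisensteinDescent_eisensteinKernelAtThreeTowerFreeOdd_proof` (its module imports this route file, so no `_holds` link can be stated here).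

/-- item stmt-BirchSwinnertonDyer-25896 · support · rank 9 · open · by planner
sources: GrossLMS1991, McCallumLMS1991, MilneADT2006, p598295
[support, by-name PACKAGE of three PUBLISHED primitives of the McCallum-road receptacle — exists
because `closes` binds only top-level items] Cassels–Tate level inputs (item 20191) ∧ Gross 1991
Prop. 3.7 (2) Frobenius congruence (23091) ∧ Gross 1991 «Heegner point minus rational torsion lies
in E⁰» (24701): exactly the three named facts consumed by
`WildKolyvaginUpperAtThreeTowerFreePrintClosedSubcells.wildKolyvaginUpperAtThreeTowerFree_of_sigmaMultiCarrier_of_jetchevMaxModThree_of_threePrimitives`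
(p598295 §2, soed-p2-w2 g4). Print, never staffed; closes only when the three facts become theorems. -/
@[route_item "route-BirchSwinnertonDyer-SemiOrdinaryEisensteinDescent", crux]
def KolyvaginPrimitivesAtThree : Prop :=
  CasselsTateLevelInputsFact ∧ GrossProp372FrobeniusCongruenceInput ∧ GrossHeegnerPointE0Input

/-- item stmt-BirchSwinnertonDyer-25897 · support · rank 9 · open · by planner
sources: Jetchev2008, Cha2005, McCallumLMS1991, p598295, p597487
[support · TREE DEBT, typed conditional] PoitouTateSelmerStructureDualityFact →
GrossHeegnerPointE0Input → GrossProp372FrobeniusCongruenceInput → (Jetchev 2008 Thm 1.2 read modulo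
3 at the maximal Tamagawa carriers, ρ̄₃ onto only, no tower: the displayed hJmax of p598295 §2).
Closable by soed-p2-w2 g5's `jetchevMaxModThree_of_literature` (JET ModP series
Theorems/Rank1ResidualJetModP*.lean, 9/15 accepted 04:11Z) as soon as it lands; the kernel feeds it
hPT and the E0 / 3.7(2) conjuncts of KolyvaginPrimitivesAtThree. Jetchev's max-form σ-divisibility
at `3 ∣ N` under `ρ̄₃` onto ONLY: on every odd-d_K Heegner frame of the wild cell and every q ∣ N,
the Kolyvagin classes are 3-divisible to depth ord₃ c_q(E/ℚ_q) (Jetchev 2008 Thm. 1.4 / Cor. 1.5 in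
the tree's `Koly.PDiv` currency). = hypothesis `hJmax` of p598295 §2 VERBATIM = the conclusion shape
of `SchneiderFree.Exact.jetchevMaxAtThree_of_literature` with its `TowerSurjThree W` binder deleted.
AUDIT (soed-p2-w2 g4, `Cruxes/WildKolyvaginUpperAtThree/SUBCELLS-JET-TOWER-w2g4.md` §2, commit
66cfc34bb849): the `bsd-jet` road-K kernel behind `jetchevMaxAtThree_o -/
@[route_item "route-BirchSwinnertonDyer-SemiOrdinaryEisensteinDescent"]
def JetchevMaxDivisibilityAtThreeModThree : Prop :=
  PoitouTateSelmerStructureDualityFact → GrossHeegnerPointE0Input → GrossProp372FrobeniusCongruenceInput → ∀ (W : WeierstrassCurve ℚ) [W.IsElliptic] [W.IsGloballyMinimal] (N : ℕ) [NeZero N] (K : Type) [Field K] [NumberField K] (Dt : Literature.NumberTheory.EllipticCurves.ModularForms.ModularParametrizationData W N) (H : Literature.NumberTheory.EllipticCurves.HeegnerDatum N (NumberField.discr K)) (ι : K →+* ℂ) (P : (W.baseChange K).toAffine.Point), Summit.BirchSwinnertonDyer.Rank1Residual.Additive.ClassO6 W 3 → W.HasSurjectiveModNGaloisRep 3 → W.analyticRank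 = 1 → W.conductorNorm ℤ = N → Literature.NumberTheory.EllipticCurves.IsImaginaryQuadratic K → Literature.NumberTheory.EllipticCurves.SatisfiesHeegnerHypothesis N K → (W.quadraticTwist (NumberField.discr K : ℚ)).entireLFunction 1 ≠ 0 → (WeierstrassCurve.Affine.Point.map ι.toRatAlgHom) P = Literature.NumberTheory.EllipticCurves.ModularForms.heegnerPointComplex Dt H → ¬ IsOfFinAddOrder P → Odd (NumberField.discr K) → NumberField.discr K ≠ -3 → ∀ (q : ℕ) [Fact q.Prime], q ∣ N → ∀ (s' : ℕ), s' ≤ padicValNat 3 ((W.baseChange ℚ_[q]).localTamagawaNumber ℤ_[q]) → ∀ (n : ℕ) (d : Literature.NumberTheory.EllipticCurves.KolyvaginHeegnerData Dt H.β ι n), Squarefree n → (∀ ℓ ∈ n.primeFactors, Literature.NumberTheory.EllipticCurves.Zhang2014.IsKolyvaginPrime N W K 3 ℓ ∧ s' ≤ Literature.NumberTheory.EllipticCurves.Zhang2014.kolyvaginIndex W 3 ℓ) → Summit.BirchSwinnertonDyer.Rank1Residual.X11b.Three.Koly.PDiv d 3 s'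

/-- item stmt-BirchSwinnertonDyer-25899 · aside (kind.auto-crux: conjecture-grade) · rank 9 · closed · proved by Summit.BirchSwinnertonDyer.BirchSwinnertonDyer.Theorems.semiOrdinaryEisensteinDescent_eisensteinKernelAtThreeMultiCarrierOdd_proof (prover) · by planner
why it might fail: auto-crux — conjecture-grade statement (statement references the registered conjecture Summit.BirchSwinnertonDyer.WAllExclAddWildRankOneSurj); it is open, so it may simply be false
sources: p598295, p597325, Jetchev2008, GrossLMS1991
[support, KERNEL‴ — SUPERSEDES kernel 24697 `EisensteinKernelAtThreeTowerFreeOdd` on the deciding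
chain; closer = XS, certified scratch soedG/SketchG.lean §K (rc 0, 0 sorry): `intro …; obtain ⟨hCT,
h372, hE0⟩ := hPr; exact semiOrdinaryEisensteinDescent_eisensteinKernelAtThreeTowerFreeOdd_proof hIn
hE'
(WildKolyvaginUpperAtThreeTowerFreePrintClosedSubcells.wildKolyvaginUpperAtThreeTowerFree_of_sigmaMultiCarrier_of_jetchevMaxModThree_of_threePrimitives
hCT h372 hE0 hJmax hJ) hW hS hPT hZ`] published inputs → E′ (24155) → Kolyvagin primitives (print) →
Jetchev max-form mod 3 (tree debt) → J‴ (research residue) → Hsieh ∧ BDP ∧ LZZ print → odd-d_K frame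
(24475, PROVED) → Poitou–Tate (print) → Z (20387) → the rung `WAllExclAddWildRankOneSurj`. After it
lands, SOED's open research binders are exactly E′ 24155 · J‴ · Z 20387. -/
@[route_item "route-BirchSwinnertonDyer-SemiOrdinaryEisensteinDescent"]
def EisensteinKernelAtThreeMultiCarrierOdd : Prop :=
  PublishedInputsWildThree → WildSplitEisensteinInclusionAtThreeRestricted → KolyvaginPrimitivesAtThree → JetchevMaxDivisibilityAtThreeModThree → WildSigmaDivisibilityAtThreeMultiCarrier → WildSplitPrintedInputsAtThree → WildSplitFrameAtThreeOddOfPrint → PoitouTateSelmerStructureDualityFact → WildRankZeroTwistAtThree → Summit.BirchSwinnertonDyer.WAllExclAddWildRankOneSurj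

-- `EisensteinKernelAtThreeMultiCarrierOdd` holds: proved by `Summit.BirchSwinnertonDyer.BirchSwinnertonDyer.Theorems.semiOrdinaryEisensteinDescent_eisensteinKernelAtThreeMultiCarrierOdd_proof` (its module imports this route file, so no `_holds` link can be stated here).

/-- item stmt-BirchSwinnertonDyer-26257 · support · rank 9 · open · by planner
why it might fail: Glue, XS: fails only if the rendered FQNs of 25897's antecedents (GrossHeegnerPointE0Input / GrossProp372FrobeniusCongruenceInput) stop being definitionally the Literature facts `jetchevMaxModThree_of_literature` consumes — certified equal today (SketchG2 rc 0).
sources: Jetchev2008, GrossLMS1991, p605565, p606426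
[support · glue, XS — closable NOW] the conj-form Poitou–Tate input implies the filed Jetchev
max-form item 25897 (whose own first antecedent, the four-conjunct PT, is simply ignored): closer =
`fun hc _ hE0 h372 =>
Summit.BirchSwinnertonDyer.BirchSwinnertonDyer.Theorems.WildKolyvaginUpperAtThreeTowerFreeJetchevMaxModThree.jetchevMaxModThree_of_literature
hc hE0 h372` (soed-p2-w2 g5's theorem; certified scratch soedG2/SketchG2.lean
`jetchevMaxOfConjGlue_proof`, rc 0, std axioms). Repairs G1 (vet tk5i g2): as filed, 25897 was not
closable from the tree because `PoitouTateSelmerStructureDualityFact` lacks IsConjCompatible. -/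
@[route_item "route-BirchSwinnertonDyer-SemiOrdinaryEisensteinDescent", crux]
def JetchevMaxOfConjGlue : Prop :=
  PoitouTateSelmerDualityConjInput → JetchevMaxDivisibilityAtThreeModThree

/-- item stmt-BirchSwinnertonDyer-26611 · support (kind.auto-crux: conjecture-grade) · rank 9 · open · by planner
why it might fail: Kernel, XS: fails only if the rendered route names stop unfolding to p609065 §3's displayed binder types (certified equal today, SketchGpV rc 0).
sources: p609065, p606694, p598295, JetchevSkinnerWan2017
[support, KERNEL-V — SUPERSEDES kernel 25899 `EisensteinKernelAtThreeMultiCarrierOdd` on the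
deciding chain; closer = XS, ZERO GLUE: `fun hF hE1V hPr hJmax hJ hW hPT hZ =>
Summit.BirchSwinnertonDyer.BirchSwinnertonDyer.Theorems.EisensteinKernelAtThreeOfValueAtOneV.wAllExclAddWildRankOneSurj_of_valueAtOneV_of_sigmaMultiCarrier_of_jetchevMaxModThree_of_primitives_of_poitouTate
hF hE1V hPr hJmax hJ hW hPT hZ` (p609065 §3, soed-p1-w2 g12; certified scratch soedV/SketchGpV.lean
rc 0 · 0 sorry)] published inputs → E_𝟙^V → Kolyvagin primitives (print) → Jetchev max-form mod 3
(derived from the conj PT via 26257) → J‴ 25898 → Hsieh ∧ BDP ∧ LZZ print → Poitou–Tate PT1 (derived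
from 23092) → Z 20387 → the rung `WAllExclAddWildRankOneSurj` (the odd-d_K frame 24475 ✓ is used
INSIDE the proof via `…_of_package_…`, not as a binder). After it lands SOED's open research binders
are exactly E_𝟙^V · J‴ 25898 · Z 20387. -/
@[route_item "route-BirchSwinnertonDyer-SemiOrdinaryEisensteinDescent", crux]
def EisensteinKernelAtThreeMultiCarrierOddOfValueAtOneV : Prop :=
  PublishedInputsWildThree → WildSplitEisensteinValueAtOneV → KolyvaginPrimitivesAtThree → JetchevMaxDivisibilityAtThreeModThree → WildSigmaDivisibilityAtThreeMultiCarrier → WildSplitPrintedInputsAtThree → PoitouTateSelmerStructureDualityFact → WildRankZeroTwistAtThree → Summit.BirchSwinnertonDyer.WAllExclAddWildRankOneSurj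

/-- item stmt-BirchSwinnertonDyer-20486 · assembly · rank 1 · closed · proved by Summit.BirchSwinnertonDyer.BirchSwinnertonDyer.Theorems.SemiOrdinaryEisensteinDescentAssembly.assembly_proof (prover) · by planner
sources: JetchevSkinnerWan2017, arXiv:1412.1767, Jetchev2008
[assembly] PublishedInputsWildThree → WildSplitEisensteinInclusionAtThree →
WildKolyvaginUpperAtThree → WildSplitWaldspurgerAtThree → WildSplitControlAtThree →
WildRankZeroTwistAtThree → WildRankOneSurjNonTowerAtThree → EisensteinKernelAtThree →
WAllExclAddWildRankOneSurj (proved as `closes` in glue.lean). -/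
@[route_item "route-BirchSwinnertonDyer-SemiOrdinaryEisensteinDescent"]
def Assembly : Prop :=
  PublishedInputsWildThree → WildSplitEisensteinInclusionAtThree → WildKolyvaginUpperAtThree → WildSplitWaldspurgerAtThree → WildSplitControlAtThree → WildRankZeroTwistAtThree → WildRankOneSurjNonTowerAtThree → EisensteinKernelAtThree → Summit.BirchSwinnertonDyer.WAllExclAddWildRankOneSurj

-- `Assembly` holds: proved by `Summit.BirchSwinnertonDyer.BirchSwinnertonDyer.Theorems.SemiOrdinaryEisensteinDescentAssembly.assembly_proof` (its module imports this route file, so no `_holds` link can be stated here).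

/-! D-0027 §2.1 — DECIDING THEOREM (planner-authored via `route open/edit --closes-file`; by planner-bsd-wall-pss3x-g3-0 2026-08-28T07:26:36Z):
its hypotheses are this route's items and its conclusion the registered leaf `Summit.BirchSwinnertonDyer.WAllExclAddWildRankOneSurj` (rung W-ALL/2@3.O6.r1.surj, D-0061) (glue_lint), and it elaborates with this file. -/

@[closes "route-BirchSwinnertonDyer-SemiOrdinaryEisensteinDescent"] theorem closes (hIn : PublishedInputsWildThree) (hE1V : WildSplitEisensteinValueAtOneV)
    (hPr : KolyvaginPrimitivesAtThree) (hPTc : PoitouTateSelmerDualityConjInput) (hGJ : JetchevMaxOfConjGlue)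
    (hJ : WildSigmaDivisibilityAtThreeMultiCarrier) (hW : WildSplitPrintedInputsAtThree)
    (hZ : WildRankZeroTwistAtThree) (hK : EisensteinKernelAtThreeMultiCarrierOddOfValueAtOneV) :
    Summit.BirchSwinnertonDyer.WAllExclAddWildRankOneSurj :=
  hK hIn hE1V hPr (hGJ hPTc) hJ hW
    (fun K _ _ => Literature.NumberTheory.GaloisCohomology.poitouTate_selmerStructure_duality_of_conj (hPTc K)) hZ

end Summit.BirchSwinnertonDyer.BirchSwinnertonDyer.Theses.SemiOrdinaryEisensteinDescent
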